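import Mathlib
import HarnessLib
import Literature.Combinatorics.Additive.IsoperimetricMethod
import Literature.Combinatorics.Additive.HamidouneRodsethRuns
import Literature.Combinatorics.Additive.CompressionTransferModP

/-!
# Hamidoune–Serra–Zémor 2006, §2 (the layers `N_i(X,Y)`, `N_i^U`, Lemma 6) and §4 «On the size
# of atoms» COMPLETE: Lemmas 15–19 and THEOREM 14 — the `4`-atoms of `X` have four elements and,
# when `|X| = 4`, the `5`-atoms of `X` have five

Topic `Literature/Combinatorics/Additive`.  Cell `mm-stpp` (D-0046), seat `mm-stpp-lit` (gen 18);
census-silent Literature shelf.  Companion of `IsoperimetricMethod.lean` (Hamidoune's `k`-atoms: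
`Isoperimetric.IsAtom k B A` = «`A` is a `k`-atom of `B`», `Isoperimetric.conn k B` = `κ_k(B)`,
the intersection property, and §2 of this paper: Theorem 7 and Proposition 8 =
`Isoperimetric.IsAtom.card_le_of_conn_le`) and of `CompressionTransferModP.lean` (§3, Theorem 10 =
`CompressionTransfer.compression_transfer`).

## Source (read at the page this session)

Y. O. Hamidoune, O. Serra, G. Zémor, *On the critical pair theory in `ℤ/pℤ`*, Acta Arith. 121
(2006) 99–115 = arXiv:math/0507561, held as `paper:arxiv-math_0507561` (LaTeX source; §2 = chunk
p0005, §4 = chunks p0008–p0009).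

## What is here (all PROVED; no `sorry`, no named facts)

* **The layers** (§2, p0005: «`N_0(X,Y) = X`, `N_1(X,Y) = (X+Y) ∖ X`,
  `N_i(X,Y) = (X + iY) ∖ (X + (i−1)Y)`, `i ≥ 2`» and, for `U ⊆ Y`, «`N_i^U` the set of elements
  `z ∈ N_i` such that `z − U ⊂ N_{i−1}` and `(z − (Y ∖ U)) ∩ N_{i−1} = ∅`»,
  «`N_i^{⊆U} = ⋃_{V ⊆ U} N_i^V`»): `AtomLayers.cum X Y i = X + iY` (iterated sumset),
  `AtomLayers.layer X Y i = N_i(X,Y)`, `AtomLayers.back X Y i z = {y ∈ Y : z − y ∈ N_i}` (so that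
  `N_{i+1}^U = {z ∈ N_{i+1} : back_i z = U}` = `AtomLayers.layerEq X Y (i+1) U` and
  `N_{i+1}^{⊆U}` = `AtomLayers.layerSub X Y (i+1) U`), with their bookkeeping.
* **Lemma 6** in its general-`U` form (the tree's `Isoperimetric.layer_step` is the case
  `U = A∖0` only): `AtomLayers.sub_mem_layerSub` («`N_{i+1}^U − U ⊂ N_i^{⊆U}`») and, in `ℤ/pℤ`,
  `AtomLayers.card_layerEq_add_card_le` («in particular `|N_{i+1}^U| ≤ |N_i^{⊆U}| − |U| + 1`»,
  by Cauchy–Davenport).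
* **The degree balance** (§4, display (7): «`Σ_{z ∈ N_i} d_+(z) = Σ_{z ∈ N_{i+1}} d_−(z)`» with
  `d_+(z) = |(z+Y) ∩ N_{i+1}|`, `d_−(z) = |(z−Y) ∩ N_{i−1}|`): `AtomLayers.sum_card_vadd_inter_eq`
  (stated for any two finsets; the layers are the printed instance).
* **Lemma 15** (p0008: «Suppose `A` is a `k`-atom of some set `X ⊂ ℤ/pℤ`.  If there is `z ∈ X + A`
  uniquely expressable as `z = x + a`, `x ∈ X` and `a ∈ A` then `|A| = k`»), in any finite abelian
  group: `AtomLayers.card_eq_of_unique_add`.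
* **Lemma 16** (p0008: «Theorem 14 holds if `ℓ_r(X) ≤ |X| + 2` for some `r`»), as the explicit
  statement `AtomLayers.card_eq_of_subset_apFinset`: if `X ⊆ ℤ/pℤ` (`|X| ≥ 4`) lies in a
  `d`-progression with `|X| + 2` terms, `A` is a `k`-atom of `X` with `k ≥ 4`,
  `|A + X| ≤ |A| + |X| + 1` and `|A| + |X| + 6 ≤ p`, `p > 32`, then `|A| = k` — via Theorem 10
  (`ℓ_d(A) ≤ |A| + 2`), the unique expression of `min + min` for a sum of two short progressions
  (`AtomLayers.exists_unique_add_of_subset_apFinset`, «the sum `X + A` can be considered as a sum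
  in `ℤ`»), and Lemma 15.
* **The bricks of Lemmas 17–18** (each a sentence of the printed proofs, cited at the sentence):
  `zero_not_mem_back` / `back_subset_erase_zero` (back-neighbour sets lie in `A* = A ∖ 0`),
  `card_layer_one_add` (`|N_1| = |A + X| − |X|`), `layerEq_succ_empty`,
  `layerSub_succ_eq_empty_of_forall`, `layerSub_succ_subset_layerEq_of_forall`,
  `layerSub_succ_eq_empty` / `layerSub_eq_empty_of_le` (Lemma 6 iterated: `N_i^{⊆U} = ∅`
  propagates upward), `unique_add_of_mem_layerEq_singleton` /
  `card_eq_of_layerEq_singleton_nonempty` (Lemma 15 in layer form: `N_1^{{a}} ≠ ∅ ⇒ |A| = k`),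
  `sdiff_add_eq` / `card_sdiff_add` (`(A ∖ U) + X = (A + X) ∖ N_1^{⊆U}`),
  `false_of_card_le_card_layerSub` and `layerEq_two_eq_empty` (atom minimality against deleting
  `U`: `N_2^U = ∅` when `k + |U| ≤ |A|`), `card_cum` / `cum_eq_univ_of_layer_eq_empty` /
  `card_add_sum_card_layer_eq` (the layers exhaust `ℤ/pℤ`: `p = |X| + Σ |N_i|`),
  `card_vadd_inter_layer_succ_le` / `card_vadd_neg_inter_layer_eq` / `mul_card_layer_succ_le`
  (out-degrees `≤ |A*|`, in-degrees `= |back|`, so `m |N_{i+1}| ≤ |N_i| |A*|`),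
  `card_layer_add_card_erase_le_succ` / `card_layer_add_card_erase_le` (Cauchy–Davenport and
  Vosper on a full layer `N_i = N_i^{A*}`: `|N_i| + |A*| ≤ |N_{i−1}| (+1)`),
  `false_of_apFinset_subset` (an atom contains no `(k+1)`-term progression, by the intersection
  property), `exists_subset_apFinset_of_card_three` (the Hamidoune–Rødseth / Vosper test on a
  three-element `A ∖ U`), `exists_eq_apFinset_of_card_pair_add` (the two-element test).
* **Lemma 17** (p0008: «Let `X` and `p` be as in Theorem 14.  Let `A` be a `4`-atom of `X`.  Then
  `|A| ≤ 5`»): `AtomLayers.card_le_five_of_isAtom_four` (`0 ∈ X`, `|X| ≥ 4`, `κ_4(X) ≤ |X| + 1`,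
  `p > |X| + 42`), by the printed layer count `|N_1| ≤ 7`, `|N_2| ≤ 11`, `|N_3| ≤ 13`,
  `|N_4| ≤ 8`, `|N_5| ≤ 3`, `N_6 = ∅`.
* **Lemma 18 = Theorem 14 (i)** (p0008–p0009: «Let `X` and `p` be as in Theorem 14.  Let `A` be a
  `4`-atom of `X`.  Then `|A| = 4`»): `AtomLayers.card_eq_four_of_isAtom_four` /
  `AtomLayers.forall_isAtom_four_card_eq` (same hypotheses), through the core count
  `AtomLayers.false_of_isAtom_four_card_five` (`|A| = 5`, `0 ∈ A`, `A*` no progression ⇒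
  `|N_1| ≤ 6`, at most three points of `N_2` of in-degree `2`, `|N_2| ≤ 8` («actually», Vosper on
  `N_1 + A*`), `|N_3| ≤ 10`, `|N_4| ≤ 10`, `|N_5| ≤ 6`, `|N_6| ≤ 2`, `N_7 = ∅`), the reduction
  «WLOG `A*` is not a progression» (`AtomLayers.eq_or_eq_neg_of_triple_subset`: three consecutive
  terms of a `d`-progression inside a four-term `e`-progression force `e = ±d`), the abstract
  Vosper step `AtomLayers.card_add_card_erase_le_of_forall` and `vadd_inter_layer_succ_subset`.
* **Lemma 19** (p0009: «Let `X, B ⊂ ℤ/pℤ` such that `|X| = 4`, `|B| ≥ 4`, `0 ∈ X ∩ B`, and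
  `|X + B| ≤ |X| + |B| + 1`.  If `p > |B| + 20`, then there is an element `z ∈ X + B` which can be
  uniquely written as `z = x + b`»): `AtomLayers.exists_unique_add_of_card_four` (`0 ∈ B` is not
  used), with the progression case `AtomLayers.exists_unique_add_of_isAP` (by a run-start
  argument) and, in the general case, the printed count `|N_1| ≤ 5`, `|N_2| ≤ 6`, `|N_3| ≤ 5`,
  `|N_4| ≤ 3`, `|N_5| ≤ 1` of the layers `N_i(B, X)` split by the four possible back-neighbour sets
  `{x₁,x₂}, {x₁,x₃}, {x₂,x₃}, X∖0` (`AtomLayers.card_layer_succ_eq_sum`, `sum_card_layerEq_le`,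
  `disjoint_layerEq`; the `(·)^+` arithmetic isolated in `arith_two` … `arith_final`).
* **Theorem 14 (ii)** (p0008: «if `|X| = 4` then the `5`-atoms of `X` have cardinality `5`»):
  `AtomLayers.card_eq_five_of_isAtom_five` (`0 ∈ X`, `|X| = 4`, `κ_5(X) ≤ |X| + 1`,
  `p > |X| + 42`), via `AtomLayers.card_le_of_conn_le'` (Proposition 8 with the numerical
  hypothesis on `p + |B|` in place of `p + k`, since here `k = 5 > |X| = 4`), Lemma 19 and
  Lemma 15.  With this, §4 of the paper is complete; §5 (Lemmas 20–22, the case `|A| = 4`,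
  `|B| = 5`) and §6 (Theorem 3) are the next additions.

## Deviations from print

* The layers are indexed from the cumulative sums `cum X Y i = X + iY` defined by recursion
  (`cum X Y (i+1) = cum X Y i + Y`), so that no `ℕ`-action on finsets is involved; `N_i^U` is
  phrased through the back-neighbour set `back`, which for `U ⊆ Y` is the printed condition.
* Lemmas 17–18 / Theorem 14 (i) are stated with `κ_4(X) ≤ |X| + 1` (what the proofs use,
  through Proposition 8 for `k = 4`); Theorem 14 prints `κ_5(X) ≤ |X| + 1`, which implies it
  whenever `X` is `5`-separable (a `5`-admissible set is `4`-admissible).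
* Theorem 14 (ii): the paper invokes Proposition 8 for `k = 5` and `|X| = 4`, outside its printed
  hypothesis `k ≤ |B|`; the proof of Proposition 8 only needs `m² + 6m + 12 < p + |B|` (and
  `|B| ≥ 2`), which is how `card_le_of_conn_le'` states it — for `|X| = 4`, `m = 1` this is
  `p > 15`.  Lemma 19's progression case is done by a run start of `X + B` along `d` instead of
  the printed lift to `ℤ` (which would need `ℓ_d(X) ≤ |X| + 2`, «clearly»).
* Lemma 18, last count: the paper bounds `|N_4 ∖ N_4^{A*}| ≤ 3` («the sets `N_3^V` for `|V| = 3`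
  and `N_4^V ≠ ∅` are disjoint and contain at least 3 elements») and reaches `|X̄| ≤ 39`; we use the
  cruder `|N_4 ∖ N_4^{A*}| ≤ 4` (four three-subsets of `A*`, one point each), reaching `42`, which
  still contradicts `p > |X| + 42`.  The reduction «WLOG `A*` not a progression» is done by the
  translation `A ↦ A − a` only (no dilation), as the printed `B = {0,1,2,3,u}` argument read in
  `ℤ/pℤ`.
* Lemma 16 is stated with the explicit numerical hypotheses its proof uses
  (`|A + X| ≤ |A| + |X| + 1`, which is `κ_k(X) ≤ |X| + 1` for the atom `A`, and
  `|A| + |X| + 6 ≤ p`, which under Theorem 14's `p > |X| + 42` follows from Proposition 8's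
  `|A| ≤ k + 2`), for every `k ≥ 4` at once.
-/

namespace Literature.Combinatorics.Additive

open Finset
open scoped Pointwise

namespace AtomLayers

section Layers

variable {G : Type*} [AddCommGroup G] [DecidableEq G]

/-- The cumulative sumset `X + iY` (`X + 0Y = X`, `X + (i+1)Y = (X + iY) + Y`).
[cite: HamidouneSerraZemor2006, §2 (definition of N_i(X,Y))] -/
def cum (X Y : Finset G) : ℕ → Finset G
  | 0 => X
  | i + 1 => cum X Y i + Y

/-- The layer `N_i(X,Y)`: `N_0 = X`, `N_{i+1} = (X + (i+1)Y) ∖ (X + iY)`.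
[cite: HamidouneSerraZemor2006, §2 (definition of N_i(X,Y))] -/
def layer (X Y : Finset G) : ℕ → Finset G
  | 0 => X
  | i + 1 => cum X Y (i + 1) \ cum X Y i

/-- The back-neighbour set of `z` in `Y` relative to the layer `N_i`: `{y ∈ Y : z − y ∈ N_i}` (for
`z ∈ N_{i+1}` this is the `V ⊆ Y` with `z ∈ N_{i+1}^V`).
[cite: HamidouneSerraZemor2006, §2 (definition of N_i^U)] -/
def back (X Y : Finset G) (i : ℕ) (z : G) : Finset G :=
  Y.filter fun y => z - y ∈ layer X Y i

/-- `N_i^U = {z ∈ N_i : z − U ⊆ N_{i−1}, (z − (Y ∖ U)) ∩ N_{i−1} = ∅}`, i.e. (for `U ⊆ Y`) the points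
of `N_i` whose back-neighbour set is exactly `U`. [cite: HamidouneSerraZemor2006, §2 (definition
of N_i^U)] -/
def layerEq (X Y : Finset G) (i : ℕ) (U : Finset G) : Finset G :=
  (layer X Y i).filter fun z => back X Y (i - 1) z = U

/-- `N_i^{⊆U} = ⋃_{V ⊆ U} N_i^V`: the points of `N_i` whose back-neighbour set lies in `U`.
[cite: HamidouneSerraZemor2006, §2 (definition of N_i^{⊆U})] -/
def layerSub (X Y : Finset G) (i : ℕ) (U : Finset G) : Finset G :=
  (layer X Y i).filter fun z => back X Y (i - 1) z ⊆ U

variable {X Y U : Finset G}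

/-- [cite: HamidouneSerraZemor2006, §2 (definition of N_i)] -/
@[simp] theorem cum_zero : cum X Y 0 = X := rfl

/-- [cite: HamidouneSerraZemor2006, §2 (definition of N_i)] -/
@[simp] theorem cum_succ (i : ℕ) : cum X Y (i + 1) = cum X Y i + Y := rfl

/-- [cite: HamidouneSerraZemor2006, §2 (definition of N_i)] -/
@[simp] theorem layer_zero : layer X Y 0 = X := rfl

/-- [cite: HamidouneSerraZemor2006, §2 (definition of N_i)] -/
theorem layer_succ (i : ℕ) : layer X Y (i + 1) = cum X Y (i + 1) \ cum X Y i := rfl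

/-- `N_1 = (X + Y) ∖ X`. [cite: HamidouneSerraZemor2006, §2 (definition of N_i)] -/
theorem layer_one : layer X Y 1 = (X + Y) \ X := rfl

/-- Membership in a positive layer. [cite: HamidouneSerraZemor2006, §2 (definition of N_i)] -/
theorem mem_layer_succ {i : ℕ} {z : G} :
    z ∈ layer X Y (i + 1) ↔ z ∈ cum X Y i + Y ∧ z ∉ cum X Y i := by
  rw [layer_succ, mem_sdiff, cum_succ]

/-- With `0 ∈ Y` the cumulative sums increase. [cite: HamidouneSerraZemor2006, §2] -/
theorem cum_subset_cum_succ (h0 : (0 : G) ∈ Y) (i : ℕ) : cum X Y i ⊆ cum X Y (i + 1) := by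
  intro z hz
  rw [cum_succ]
  simpa using add_mem_add hz h0

/-- With `0 ∈ Y`, `X + iY ⊆ X + jY` for `i ≤ j`. [cite: HamidouneSerraZemor2006, §2] -/
theorem cum_mono (h0 : (0 : G) ∈ Y) {i j : ℕ} (hij : i ≤ j) : cum X Y i ⊆ cum X Y j := by
  induction hij with
  | refl => exact Subset.rfl
  | step _ ih => exact ih.trans (cum_subset_cum_succ h0 _)

/-- `X ⊆ X + iY` when `0 ∈ Y`. [cite: HamidouneSerraZemor2006, §2] -/
theorem subset_cum (h0 : (0 : G) ∈ Y) (i : ℕ) : X ⊆ cum X Y i :=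
  (cum_mono h0 (Nat.zero_le i) : cum X Y 0 ⊆ cum X Y i)

/-- A layer lies in its cumulative sum. [cite: HamidouneSerraZemor2006, §2] -/
theorem layer_subset_cum (i : ℕ) : layer X Y i ⊆ cum X Y i := by
  cases i with
  | zero => exact Subset.rfl
  | succ i => rw [layer_succ]; exact sdiff_subset

/-- Translating back by an element of `Y` from `X + (i+1)Y ∖ X + iY` never lands below `X + iY`'s
predecessor: for `z ∈ N_{i+2}` and `y ∈ Y`, `z − y ∉ X + iY`. [cite: HamidouneSerraZemor2006, §2
(proof of Lemma 6: «since z ∈ N_{i+1} we must have j = i»)] -/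
theorem sub_not_mem_cum {i : ℕ} {z y : G} (hz : z ∈ layer X Y (i + 2)) (hy : y ∈ Y) :
    z - y ∉ cum X Y i := by
  intro h
  rw [mem_layer_succ] at hz
  apply hz.2
  rw [cum_succ]
  have := add_mem_add h hy
  rwa [sub_add_cancel] at this

/-- A point of `N_{i+1}` translated back by `y ∈ Y` into `X + iY` lands in the layer `N_i` (when
`i ≥ 1`; for `i = 0` the layer IS `X`). [cite: HamidouneSerraZemor2006, §2 (proof of Lemma 6)] -/
theorem sub_mem_layer_of_mem_cum {i : ℕ} {z y : G} (hz : z ∈ layer X Y (i + 1)) (hy : y ∈ Y)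
    (h : z - y ∈ cum X Y i) : z - y ∈ layer X Y i := by
  cases i with
  | zero => simpa using h
  | succ i =>
    rw [mem_layer_succ, ← cum_succ]
    exact ⟨h, sub_not_mem_cum hz hy⟩

/-- Every point of a positive layer has a back-neighbour («`z ∈ N_{i+1}`, `u ∈ U` and
`z' = z − u ∈ N_i`»): for `z ∈ N_{i+1}` some `y ∈ Y` has `z − y ∈ N_i`.
[cite: HamidouneSerraZemor2006, §2 (definition of N_i, proof of Lemma 6)] -/
theorem exists_sub_mem_layer {i : ℕ} {z : G} (hz : z ∈ layer X Y (i + 1)) :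
    ∃ y ∈ Y, z - y ∈ layer X Y i := by
  have hz' := hz
  rw [mem_layer_succ] at hz'
  obtain ⟨w, hw, y, hy, rfl⟩ := mem_add.1 hz'.1
  refine ⟨y, hy, sub_mem_layer_of_mem_cum hz hy ?_⟩
  rwa [add_sub_cancel_right]

/-- Membership in the back-neighbour set. [cite: HamidouneSerraZemor2006, §2 (definition of
N_i^U)] -/
theorem mem_back {i : ℕ} {z y : G} : y ∈ back X Y i z ↔ y ∈ Y ∧ z - y ∈ layer X Y i := by
  rw [back, mem_filter]

/-- The back-neighbour set lies in `Y`. [cite: HamidouneSerraZemor2006, §2 (definition of N_i^U)] -/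
theorem back_subset (i : ℕ) (z : G) : back X Y i z ⊆ Y := filter_subset _ _

/-- The back-neighbour set of a point of a positive layer is nonempty.
[cite: HamidouneSerraZemor2006, §2 (proof of Lemma 6)] -/
theorem back_nonempty {i : ℕ} {z : G} (hz : z ∈ layer X Y (i + 1)) : (back X Y i z).Nonempty := by
  obtain ⟨y, hy, hzy⟩ := exists_sub_mem_layer hz
  exact ⟨y, mem_back.2 ⟨hy, hzy⟩⟩

/-- Membership in `N_{i+1}^U`. [cite: HamidouneSerraZemor2006, §2 (definition of N_i^U)] -/
theorem mem_layerEq_succ {i : ℕ} {z : G} :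
    z ∈ layerEq X Y (i + 1) U ↔ z ∈ layer X Y (i + 1) ∧ back X Y i z = U := by
  rw [layerEq, mem_filter, Nat.add_sub_cancel]

/-- Membership in `N_{i+1}^{⊆U}`. [cite: HamidouneSerraZemor2006, §2 (definition of N_i^{⊆U})] -/
theorem mem_layerSub_succ {i : ℕ} {z : G} :
    z ∈ layerSub X Y (i + 1) U ↔ z ∈ layer X Y (i + 1) ∧ back X Y i z ⊆ U := by
  rw [layerSub, mem_filter, Nat.add_sub_cancel]

/-- `N_i^U ⊆ N_i^{⊆U} ⊆ N_i`. [cite: HamidouneSerraZemor2006, §2 (definition of N_i^{⊆U})] -/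
theorem layerEq_subset_layerSub (i : ℕ) : layerEq X Y i U ⊆ layerSub X Y i U := by
  intro z hz
  rw [layerEq, mem_filter] at hz
  rw [layerSub, mem_filter]
  exact ⟨hz.1, hz.2.le⟩

/-- `N_i^{⊆U} ⊆ N_i`. [cite: HamidouneSerraZemor2006, §2 (definition of N_i^{⊆U})] -/
theorem layerSub_subset_layer (i : ℕ) : layerSub X Y i U ⊆ layer X Y i := filter_subset _ _

/-- `N_i^{⊆U}` is the union of the `N_i^V`, `V ⊆ U`. [cite: HamidouneSerraZemor2006, §2
(definition of N_i^{⊆U})] -/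
theorem layerSub_eq_biUnion (i : ℕ) :
    layerSub X Y i U = U.powerset.biUnion fun V => layerEq X Y i V := by
  ext z
  rw [layerSub, mem_filter, mem_biUnion]
  constructor
  · rintro ⟨hz, hsub⟩
    exact ⟨back X Y (i - 1) z, mem_powerset.2 hsub, by rw [layerEq, mem_filter]; exact ⟨hz, rfl⟩⟩
  · rintro ⟨V, hV, hz⟩
    rw [layerEq, mem_filter] at hz
    rw [mem_powerset] at hV
    exact ⟨hz.1, hz.2.symm ▸ hV⟩

/-- **Lemma 6** («if `N_{i+1}^U ≠ ∅` then `N_{i+1}^U − U ⊂ N_i^{⊆U}`»), for `i ≥ 1`: for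
`z ∈ N_{i+1}^U` and `u ∈ U`, the point `z' = z − u` lies in `N_i`, and every back-neighbour `v` of
`z'` is a back-neighbour of `z` («`z − v = z' − v + u ∈ N_j` for some `j < i+1`; since
`z ∈ N_{i+1}` we must have `j = i`: this implies `V ⊂ U`»).  Valid in any abelian group; `U ⊆ Y`
is not even needed in this direction. [cite: HamidouneSerraZemor2006, §2, Lemma 6] -/
theorem sub_mem_layerSub {i : ℕ} (hi : 1 ≤ i) {z : G} (hz : z ∈ layerEq X Y (i + 1) U) {u : G}
    (hu : u ∈ U) : z - u ∈ layerSub X Y i U := by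
  obtain ⟨i, rfl⟩ : ∃ j, i = j + 1 := ⟨i - 1, by omega⟩
  rw [mem_layerEq_succ] at hz
  obtain ⟨hzN, hback⟩ := hz
  have huB : u ∈ back X Y (i + 1) z := hback.symm ▸ hu
  obtain ⟨huY, hzu⟩ := mem_back.1 huB
  rw [mem_layerSub_succ]
  refine ⟨hzu, fun v hv => ?_⟩
  obtain ⟨hvY, hzuv⟩ := mem_back.1 hv
  -- `z − v = (z − u − v) + u ∈ X + (i+1)Y`, and not below, since `z ∈ N_{i+2}`
  rw [← hback, mem_back]
  refine ⟨hvY, sub_mem_layer_of_mem_cum hzN hvY ?_⟩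
  rw [cum_succ]
  have := add_mem_add (layer_subset_cum _ hzuv) huY
  rwa [show z - u - v + u = z - v by abel] at this

end Layers

section LayersModP

variable {p : ℕ} [hp : Fact p.Prime]

/-- A positive layer misses `X`, so it is not all of `ℤ/pℤ` when `X ≠ ∅` and `0 ∈ Y`.
[cite: HamidouneSerraZemor2006, §2 (definition of N_i)] -/
theorem card_layer_succ_lt {X Y : Finset (ZMod p)} (hX : X.Nonempty) (h0 : (0 : ZMod p) ∈ Y)
    (i : ℕ) : #(layer X Y (i + 1)) < p := by
  obtain ⟨x, hx⟩ := hX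
  have hxN : x ∉ layer X Y (i + 1) := by
    rw [mem_layer_succ]
    exact fun h => h.2 (subset_cum h0 i hx)
  calc #(layer X Y (i + 1)) < #(univ : Finset (ZMod p)) :=
        card_lt_card ⟨subset_univ _, fun h => hxN (h (mem_univ x))⟩
    _ = p := by rw [card_univ, ZMod.card]

/-- **Lemma 6, «in particular»**: `|N_{i+1}^U| ≤ |N_i^{⊆U}| − |U| + 1` whenever `N_{i+1}^U ≠ ∅`
(`i ≥ 1`, `X ≠ ∅`, `0 ∈ Y`; by the Cauchy–Davenport theorem applied to `N_{i+1}^U − U`).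
[cite: HamidouneSerraZemor2006, §2, Lemma 6] -/
theorem card_layerEq_add_card_le {X Y U : Finset (ZMod p)} (hX : X.Nonempty)
    (h0 : (0 : ZMod p) ∈ Y) {i : ℕ} (hi : 1 ≤ i) (hne : (layerEq X Y (i + 1) U).Nonempty) :
    #(layerEq X Y (i + 1) U) + #U ≤ #(layerSub X Y i U) + 1 := by
  classical
  obtain ⟨j, rfl⟩ : ∃ j, i = j + 1 := ⟨i - 1, by omega⟩
  have hUne : U.Nonempty := by
    obtain ⟨z, hz⟩ := hne
    rw [mem_layerEq_succ] at hz
    rw [← hz.2]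
    exact back_nonempty hz.1
  refine Isoperimetric.card_add_card_le_of_forall_add_neg_mem hne hUne
    (fun z hz u hu => ?_) ?_
  · rw [← sub_eq_add_neg]
    exact sub_mem_layerSub hi hz hu
  · exact (card_le_card (layerSub_subset_layer _)).trans_lt (card_layer_succ_lt hX h0 j)

end LayersModP

/-! ## The degree balance (display (7)) -/

section Balance

variable {G : Type*} [AddCommGroup G] [DecidableEq G]

/-- **Counting in two ways** («by counting in two ways the number of couples `(z, z')` such that
`z ∈ N_i`, `z' ∈ N_{i+1}` and `z' − z ∈ Y`, we have `Σ_{z ∈ N_i} d_+(z) = Σ_{z ∈ N_{i+1}} d_−(z)`»,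
`d_+(z) = |(z + Y) ∩ N_{i+1}|`, `d_−(z') = |(z' − Y) ∩ N_i|`), for arbitrary finsets `S`, `T` in
place of `N_i`, `N_{i+1}`. [cite: HamidouneSerraZemor2006, §4, display (7)] -/
theorem sum_card_vadd_inter_eq (S T Y : Finset G) :
    ∑ z ∈ S, #((z +ᵥ Y) ∩ T) = ∑ t ∈ T, #((t +ᵥ -Y) ∩ S) := by
  classical
  have h1 : ∀ z, #((z +ᵥ Y) ∩ T) = ∑ t ∈ T, if t - z ∈ Y then 1 else 0 := by
    intro z
    rw [← card_filter]
    congr 1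
    ext t
    simp only [mem_inter, mem_filter, mem_vadd_finset, vadd_eq_add]
    constructor
    · rintro ⟨⟨y, hy, rfl⟩, ht⟩
      exact ⟨ht, by rwa [add_sub_cancel_left]⟩
    · rintro ⟨ht, h⟩
      exact ⟨⟨t - z, h, by abel⟩, ht⟩
  have h2 : ∀ t, #((t +ᵥ -Y) ∩ S) = ∑ z ∈ S, if t - z ∈ Y then 1 else 0 := by
    intro t
    rw [← card_filter]
    congr 1
    ext z
    simp only [mem_inter, mem_filter, mem_vadd_finset, vadd_eq_add, mem_neg']
    constructor
    · rintro ⟨⟨y, hy, rfl⟩, hz⟩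
      exact ⟨hz, by rwa [sub_add_cancel_left]⟩
    · rintro ⟨hz, h⟩
      exact ⟨⟨-(t - z), by rwa [neg_neg], by abel⟩, hz⟩
  simp_rw [h1, h2]
  exact sum_comm

end Balance

/-! ## Lemma 15: a uniquely expressible sum forces `|A| = k` -/

section UniqueExpression

variable {G : Type*} [AddCommGroup G] [Fintype G] [DecidableEq G]

/-- **Lemma 15.** «Suppose `A` is a `k`-atom of some set `X`.  If there is `z ∈ X + A` uniquely
expressable as `z = x + a`, `x ∈ X` and `a ∈ A` then `|A| = k`.»  («If `|A| > k` then
`A' = A ∖ {a}` satisfies `|X + A'| − |A'| ≤ |X + A| − |A|` which contradicts `A` being a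
`k`-atom.»)  Any finite abelian group. [cite: HamidouneSerraZemor2006, §4, Lemma 15] -/
theorem card_eq_of_unique_add {k : ℕ} {X A : Finset G} (hA : Isoperimetric.IsAtom k X A)
    {a x : G} (ha : a ∈ A) (hx : x ∈ X)
    (huniq : ∀ a' ∈ A, ∀ x' ∈ X, a' + x' = a + x → a' = a) : #A = k := by
  classical
  obtain ⟨⟨⟨hkA, hAG⟩, hfrag⟩, hmin⟩ := hA
  by_contra hne
  have hXne : X.Nonempty := ⟨x, hx⟩
  have hnot : a + x ∉ A.erase a + X := by
    intro h
    obtain ⟨a', ha', x', hx', he⟩ := mem_add.1 h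
    exact (mem_erase.1 ha').1 (huniq a' (mem_of_mem_erase ha') x' hx' he)
  have hsub : A.erase a + X ⊆ (A + X).erase (a + x) := fun z hz =>
    mem_erase.2 ⟨fun h => hnot (h ▸ hz), add_subset_add (erase_subset _ _) Subset.rfl hz⟩
  have h1 := card_le_card hsub
  rw [card_erase_of_mem (add_mem_add ha hx)] at h1
  have h2 := card_erase_of_mem ha
  have h3 : #(A.erase a) ≤ #(A.erase a + X) := card_le_card_add_right hXne
  have h4 : #A ≤ #(A + X) := card_le_card_add_right hXne
  have hadm : Isoperimetric.IsAdm k X (A.erase a) := ⟨by omega, by omega⟩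
  have h5 := Isoperimetric.conn_le hadm
  have h6 := hmin (A.erase a) ⟨hadm, by omega⟩
  omega

end UniqueExpression

/-! ## Lemma 16: Theorem 14 for a compressed `X` -/

section Compressed

variable {p : ℕ} [hp : Fact p.Prime]

/-- Positions in a `d`-run: for `w ∈ {c + i d : i < n}` (`n ≤ p`, `d ≠ 0`), `((w − c) d⁻¹).val`
is that `i`. [folklore] -/
private theorem pos_spec {d c w : ZMod p} (hd : d ≠ 0) {n : ℕ} (hn : n ≤ p)
    (hw : w ∈ apFinset c d n) :
    ((w - c) * d⁻¹).val < n ∧ w = c + ((w - c) * d⁻¹).val • d := by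
  obtain ⟨i, hi, rfl⟩ := mem_apFinset.1 hw
  have h : (c + i • d - c) * d⁻¹ = (i : ZMod p) := by
    rw [add_sub_cancel_left, nsmul_eq_mul, mul_assoc, mul_inv_cancel₀ hd, mul_one]
  rw [h, ZMod.val_natCast, Nat.mod_eq_of_lt (by omega)]
  exact ⟨hi, rfl⟩

/-- **«The sum can really be considered as a sum in `ℤ`»**: if `U` lies in a `d`-progression with
`M` terms and `V` in one with `L` terms, `M + L ≤ p + 1`, `d ≠ 0`, `U, V ≠ ∅`, then some sum
`a + x` (`a ∈ U`, `x ∈ V`) is uniquely expressible — the sum of the two first occupied terms.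
[cite: HamidouneSerraZemor2006, §3 (proof of Lemma 11) and §4 (proof of Lemma 16: «There is
therefore z ∈ X + A uniquely expressable»)] -/
theorem exists_unique_add_of_subset_apFinset {U V : Finset (ZMod p)} {u v d : ZMod p} (hd : d ≠ 0)
    {M L : ℕ} (hU : U ⊆ apFinset u d M) (hV : V ⊆ apFinset v d L) (hML : M + L ≤ p + 1)
    (hUne : U.Nonempty) (hVne : V.Nonempty) :
    ∃ a ∈ U, ∃ x ∈ V, ∀ a' ∈ U, ∀ x' ∈ V, a' + x' = a + x → a' = a ∧ x' = x := by
  classical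
  -- both progressions are genuinely occupied, so `M, L ≥ 1` and `M, L ≤ p`
  have hM1 : 1 ≤ M := by
    obtain ⟨a, ha⟩ := hUne
    obtain ⟨i, hi, -⟩ := mem_apFinset.1 (hU ha)
    omega
  have hL1 : 1 ≤ L := by
    obtain ⟨x, hx⟩ := hVne
    obtain ⟨i, hi, -⟩ := mem_apFinset.1 (hV hx)
    omega
  have hMp : M ≤ p := by omega
  have hLp : L ≤ p := by omega
  set posU : ZMod p → ℕ := fun w => ((w - u) * d⁻¹).val with hposU
  set posV : ZMod p → ℕ := fun w => ((w - v) * d⁻¹).val with hposV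
  have hPU : ∀ w ∈ U, posU w < M ∧ w = u + posU w • d := fun w hw => pos_spec hd hMp (hU hw)
  have hPV : ∀ w ∈ V, posV w < L ∧ w = v + posV w • d := fun w hw => pos_spec hd hLp (hV hw)
  obtain ⟨a, ha, hamin⟩ := U.exists_min_image posU hUne
  obtain ⟨x, hx, hxmin⟩ := V.exists_min_image posV hVne
  refine ⟨a, ha, x, hx, fun a' ha' x' hx' he => ?_⟩
  obtain ⟨hi, hae⟩ := hPU a ha
  obtain ⟨hj, hxe⟩ := hPV x hx
  obtain ⟨hi', hae'⟩ := hPU a' ha'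
  obtain ⟨hj', hxe'⟩ := hPV x' hx'
  have hsum : (posU a' + posV x') • d = (posU a + posV x) • d := by
    have h1 : a' + x' = u + v + (posU a' + posV x') • d := by
      calc a' + x' = (u + posU a' • d) + (v + posV x' • d) := by rw [← hae', ← hxe']
        _ = u + v + (posU a' + posV x') • d := by rw [add_nsmul]; abel
    have h2 : a + x = u + v + (posU a + posV x) • d := by
      calc a + x = (u + posU a • d) + (v + posV x • d) := by rw [← hae, ← hxe]
        _ = u + v + (posU a + posV x) • d := by rw [add_nsmul]; abel
    exact add_left_cancel (h1.symm.trans (he.trans h2))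
  have heq := HamidouneRodseth.nat_eq_of_nsmul_eq hd (by omega) (by omega) hsum
  have h1 := hamin a' ha'
  have h2 := hxmin x' hx'
  have hia : posU a' = posU a := by omega
  have hjx : posV x' = posV x := by omega
  exact ⟨by rw [hae', hae, hia], by rw [hxe', hxe, hjx]⟩

/-- **Lemma 16** («Theorem 14 holds if `ℓ_r(X) ≤ |X| + 2` for some `r`»), explicit form: if
`X` (`|X| ≥ 4`) lies in a `d`-progression with `|X| + 2` terms, `A` is a `k`-atom of `X`
(`k ≥ 4`) with `|A + X| ≤ |A| + |X| + 1` (i.e. `κ_k(X) ≤ |X| + 1`), `|A| + |X| + 6 ≤ p` and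
`p > 32`, then `|A| = k`.  («Suppose on the contrary that `A` is a `k`-atom of `X` of size
`|A| > k ≥ 4`.  By Theorem 10 we have `ℓ_r(A) ≤ |A| + 2` so that the sum `X + A` can be
considered as a sum in `ℤ`.  There is therefore `z ∈ X + A` uniquely expressable as `z = x + a`,
`x ∈ X`, `a ∈ A`, contradicting Lemma 15.») [cite: HamidouneSerraZemor2006, §4, Lemma 16] -/
theorem card_eq_of_subset_apFinset (hp32 : 32 < p) {X A : Finset (ZMod p)} {k : ℕ} (hk : 4 ≤ k)
    (hA : Isoperimetric.IsAtom k X A) {x₀ d : ZMod p} (hd : d ≠ 0) (hX4 : 4 ≤ #X)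
    (hX : X ⊆ apFinset x₀ d (#X + 2)) (hAX : #(A + X) ≤ #A + #X + 1)
    (hpAX : #A + #X + 6 ≤ p) : #A = k := by
  classical
  have hkA : k ≤ #A := hA.1.1.1
  by_contra hne
  have h5 : 5 ≤ #A := by omega
  -- Theorem 10: `A` is compressed as well
  obtain ⟨a₀, haA⟩ := CompressionTransfer.compression_transfer hp32 hd h5 hX4 hAX (by omega) hX
  -- so `A + X` is a sum of integers and has a uniquely expressible element
  have hAne : A.Nonempty := card_pos.1 (by omega)
  have hXne : X.Nonempty := card_pos.1 (by omega)
  obtain ⟨a, ha, x, hx, huniq⟩ :=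
    exists_unique_add_of_subset_apFinset hd haA hX (by omega) hAne hXne
  exact hne (card_eq_of_unique_add hA ha hx fun a' ha' x' hx' he => (huniq a' ha' x' hx' he).1)

end Compressed

/-! ## The bricks of Lemmas 17–18 -/

section Bricks

variable {G : Type*} [AddCommGroup G] [DecidableEq G]
variable {X A U : Finset G}

/-- Back-neighbours relative to `N_0 = X` are the first summands of the representations
`z = a + x`. [cite: HamidouneSerraZemor2006, §2 (definition of N_i^U)] -/
theorem mem_back_zero {z a : G} : a ∈ back X A 0 z ↔ a ∈ A ∧ z - a ∈ X := by
  rw [mem_back, layer_zero]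

/-- `0` is never a back-neighbour of a point of a positive layer (the layers are disjoint).
[cite: HamidouneSerraZemor2006, §4 (proof of Lemma 17: «N_i = N_i^{A*} for i ≥ 4»)] -/
theorem zero_not_mem_back {i : ℕ} {z : G} (hz : z ∈ layer X A (i + 1)) :
    (0 : G) ∉ back X A i z := by
  rw [mem_back, sub_zero]
  rintro ⟨-, h⟩
  rw [mem_layer_succ] at hz
  exact hz.2 (layer_subset_cum i h)

/-- Hence back-neighbour sets lie in `A* = A ∖ {0}`. [cite: HamidouneSerraZemor2006, §4 (proof of
Lemma 17)] -/
theorem back_subset_erase_zero {i : ℕ} {z : G} (hz : z ∈ layer X A (i + 1)) :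
    back X A i z ⊆ A.erase 0 :=
  fun _ hy => mem_erase.2 ⟨fun h => zero_not_mem_back hz (h ▸ hy), back_subset i z hy⟩

/-- `X + 1·A = A + X`. [cite: HamidouneSerraZemor2006, §2 (definition of N_i)] -/
theorem cum_one : cum X A 1 = A + X := by
  rw [cum_succ, cum_zero, add_comm]

/-- `N_1 = (A + X) ∖ X`. [cite: HamidouneSerraZemor2006, §2 (definition of N_i)] -/
theorem layer_one' : layer X A 1 = (A + X) \ X := by
  rw [layer_one, add_comm]

/-- With `0 ∈ A`, `|N_1| + |X| = |A + X|`. [cite: HamidouneSerraZemor2006, §2 (proof of Theorem 7: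
«|N_1| = |B + A| − |B|»)] -/
theorem card_layer_one_add (h0 : (0 : G) ∈ A) : #(layer X A 1) + #X = #(A + X) := by
  rw [layer_one']
  apply card_sdiff_add_card_eq_card
  intro x hx
  simpa using add_mem_add h0 hx

/-- `N_{i+1}^∅ = ∅` (every point of a positive layer has a back-neighbour).
[cite: HamidouneSerraZemor2006, §2 (proof of Lemma 6)] -/
theorem layerEq_succ_empty (i : ℕ) : layerEq X A (i + 1) ∅ = ∅ := by
  rw [← not_nonempty_iff_eq_empty]
  rintro ⟨z, hz⟩
  rw [mem_layerEq_succ] at hz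
  have := back_nonempty hz.1
  rw [hz.2] at this
  exact not_nonempty_empty this

/-- `N_i^{⊆U}` grows with `U`. [cite: HamidouneSerraZemor2006, §2 (definition of N_i^{⊆U})] -/
theorem layerSub_mono {i : ℕ} {U V : Finset G} (h : U ⊆ V) : layerSub X A i U ⊆ layerSub X A i V := by
  intro z hz
  rw [layerSub, mem_filter] at hz ⊢
  exact ⟨hz.1, hz.2.trans h⟩

/-- If every `N_{i+1}^V` with `∅ ≠ V ⊆ U` is empty then `N_{i+1}^{⊆U} = ∅`.
[cite: HamidouneSerraZemor2006, §2 (definition of N_i^{⊆U})] -/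
theorem layerSub_succ_eq_empty_of_forall {i : ℕ}
    (h : ∀ V ⊆ U, V.Nonempty → layerEq X A (i + 1) V = ∅) : layerSub X A (i + 1) U = ∅ := by
  rw [← not_nonempty_iff_eq_empty]
  rintro ⟨z, hz⟩
  rw [mem_layerSub_succ] at hz
  have hzE : z ∈ layerEq X A (i + 1) (back X A i z) := mem_layerEq_succ.2 ⟨hz.1, rfl⟩
  rw [h _ hz.2 (back_nonempty hz.1)] at hzE
  exact notMem_empty _ hzE

/-- If every `N_{i+1}^V` with `∅ ≠ V ⊊ U` is empty then `N_{i+1}^{⊆U} = N_{i+1}^U`.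
[cite: HamidouneSerraZemor2006, §2 (definition of N_i^{⊆U})] -/
theorem layerSub_succ_subset_layerEq_of_forall {i : ℕ}
    (h : ∀ V ⊆ U, V ≠ U → V.Nonempty → layerEq X A (i + 1) V = ∅) :
    layerSub X A (i + 1) U ⊆ layerEq X A (i + 1) U := by
  intro z hz
  rw [mem_layerSub_succ] at hz
  have hzE : z ∈ layerEq X A (i + 1) (back X A i z) := mem_layerEq_succ.2 ⟨hz.1, rfl⟩
  by_cases heq : back X A i z = U
  · rwa [heq] at hzE
  · rw [h _ hz.2 heq (back_nonempty hz.1)] at hzE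
    exact absurd hzE (notMem_empty _)

/-- **Lemma 6 iterated**: `N_i^{⊆U} = ∅` propagates to all higher layers (`i ≥ 1`).
[cite: HamidouneSerraZemor2006, §2, Lemma 6] -/
theorem layerSub_succ_eq_empty {i : ℕ} (hi : 1 ≤ i) (h : layerSub X A i U = ∅) :
    layerSub X A (i + 1) U = ∅ := by
  rw [← not_nonempty_iff_eq_empty]
  rintro ⟨z, hz⟩
  rw [mem_layerSub_succ] at hz
  obtain ⟨hzN, hsub⟩ := hz
  obtain ⟨u, hu⟩ := back_nonempty hzN
  have hzE : z ∈ layerEq X A (i + 1) (back X A i z) := mem_layerEq_succ.2 ⟨hzN, rfl⟩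
  have h1 := sub_mem_layerSub hi hzE hu
  have h2 := layerSub_mono (X := X) (A := A) (i := i) hsub h1
  rw [h] at h2
  exact notMem_empty _ h2

/-- `N_i^{⊆U} = ∅` for all `j ≥ i ≥ 1` once it holds at `i`. [cite: HamidouneSerraZemor2006, §2,
Lemma 6] -/
theorem layerSub_eq_empty_of_le {i j : ℕ} (hi : 1 ≤ i) (hij : i ≤ j) (h : layerSub X A i U = ∅) :
    layerSub X A j U = ∅ := by
  induction hij with
  | refl => exact h
  | @step m hle ih =>
    have : i ≤ m := hle
    exact layerSub_succ_eq_empty (by omega) ih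

/-- **Unique expression = a non-empty `N_1^{{a}}`**: `z ∈ N_1^{{a}}` means `z = a + (z − a)` is the
only representation of `z` in `A + X`. [cite: HamidouneSerraZemor2006, §4 (proof of Lemma 19:
«This implies N_1^x = ∅ for every x ∈ X*»)] -/
theorem unique_add_of_mem_layerEq_singleton {z a : G} (hz : z ∈ layerEq X A 1 {a}) :
    a ∈ A ∧ z - a ∈ X ∧ ∀ a' ∈ A, ∀ x' ∈ X, a' + x' = a + (z - a) → a' = a := by
  rw [mem_layerEq_succ] at hz
  obtain ⟨-, hback⟩ := hz
  have ha : a ∈ back X A 0 z := by rw [hback]; exact mem_singleton_self a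
  obtain ⟨haA, hzx⟩ := mem_back_zero.1 ha
  refine ⟨haA, hzx, fun a' ha' x' hx' he => ?_⟩
  rw [add_sub_cancel] at he
  have : a' ∈ back X A 0 z := by
    rw [mem_back_zero, ← he, add_sub_cancel_left]
    exact ⟨ha', hx'⟩
  rw [hback] at this
  exact mem_singleton.1 this

/-- **Lemma 15 in layer form**: a `k`-atom `A` of `X` with some `N_1^{{a}} ≠ ∅` has `|A| = k`.
[cite: HamidouneSerraZemor2006, §4, Lemma 15] -/
theorem card_eq_of_layerEq_singleton_nonempty [Fintype G] {k : ℕ}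
    (hA : Isoperimetric.IsAtom k X A) {a : G} (h : (layerEq X A 1 {a}).Nonempty) : #A = k := by
  obtain ⟨z, hz⟩ := h
  obtain ⟨haA, hzx, huniq⟩ := unique_add_of_mem_layerEq_singleton hz
  exact card_eq_of_unique_add hA haA hzx huniq

/-- **Deleting `U` from `A`**: with `0 ∈ A ∖ U`, `(A ∖ U) + X = (A + X) ∖ N_1^{⊆U}` — a point of
`N_1` survives exactly when one of its back-neighbours lies outside `U`.
[cite: HamidouneSerraZemor2006, §4 (proof of Lemma 17: «A' = A ∖ {a,b} satisfies
|X+A'| − |A'| ≤ |X+A| − |A|»)] -/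
theorem sdiff_add_eq (h0 : (0 : G) ∈ A) (h0U : (0 : G) ∉ U) :
    (A \ U) + X = (A + X) \ layerSub X A 1 U := by
  ext z
  rw [mem_sdiff, mem_layerSub_succ]
  constructor
  · intro hz
    obtain ⟨a, ha, x, hx, rfl⟩ := mem_add.1 hz
    rw [mem_sdiff] at ha
    refine ⟨add_mem_add ha.1 hx, fun h => ha.2 (h.2 ?_)⟩
    rw [mem_back_zero, add_sub_cancel_left]
    exact ⟨ha.1, hx⟩
  · rintro ⟨hzAX, hnot⟩
    by_cases hzX : z ∈ X
    · rw [← zero_add z]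
      exact add_mem_add (mem_sdiff.2 ⟨h0, h0U⟩) hzX
    · have hz1 : z ∈ layer X A 1 := by
        rw [layer_one', mem_sdiff]; exact ⟨hzAX, hzX⟩
      have : ¬ (back X A 0 z ⊆ U) := fun h => hnot ⟨hz1, h⟩
      obtain ⟨a, ha, haU⟩ := not_subset.1 this
      obtain ⟨haA, hzx⟩ := mem_back_zero.1 ha
      rw [← add_sub_cancel a z]
      exact add_mem_add (mem_sdiff.2 ⟨haA, haU⟩) hzx

/-- Hence `|(A ∖ U) + X| + |N_1^{⊆U}| = |A + X|`. [cite: HamidouneSerraZemor2006, §4 (proof of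
Lemma 17)] -/
theorem card_sdiff_add (h0 : (0 : G) ∈ A) (h0U : (0 : G) ∉ U) :
    #((A \ U) + X) + #(layerSub X A 1 U) = #(A + X) := by
  rw [sdiff_add_eq h0 h0U]
  apply card_sdiff_add_card_eq_card
  exact (layerSub_subset_layer _).trans ((layer_subset_cum 1).trans (by rw [cum_one]))

/-- **Atom minimality against deletion**: if `A ∋ 0` is a `k`-atom of `X`, `∅ ≠ U ⊆ A ∖ {0}`,
`k + |U| ≤ |A|` and `|N_1^{⊆U}| ≥ |U|`, then `A ∖ U` would be a smaller `k`-fragment — impossible.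
[cite: HamidouneSerraZemor2006, §4 (proof of Lemma 17: «which contradicts A being a 4-atom»)] -/
theorem false_of_card_le_card_layerSub [Fintype G] {k : ℕ} (hA : Isoperimetric.IsAtom k X A)
    (h0 : (0 : G) ∈ A) (hUA : U ⊆ A) (h0U : (0 : G) ∉ U) (hU : U.Nonempty) (hk : k + #U ≤ #A)
    (hcard : #U ≤ #(layerSub X A 1 U)) : False := by
  classical
  obtain ⟨⟨⟨hkA, hAG⟩, hfrag⟩, hmin⟩ := hA
  have h1 := card_sdiff_add (X := X) h0 h0U
  have h2 : #(A \ U) = #A - #U := card_sdiff_of_subset hUA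
  have hadm : Isoperimetric.IsAdm k X (A \ U) := ⟨by omega, by omega⟩
  have h5 := Isoperimetric.conn_le hadm
  have h6 := hmin (A \ U) ⟨hadm, by omega⟩
  have := hU.card_pos
  omega

/-- **Telescoping**: `|X + nA| = |X| + Σ_{i=1}^{n} |N_i|` (`0 ∈ A`).
[cite: HamidouneSerraZemor2006, §2 (proof of Theorem 7: «ℤ_p = B ∪ N_1 ∪ … ∪ N_t»)] -/
theorem card_cum (h0 : (0 : G) ∈ A) (n : ℕ) :
    #(cum X A n) = #X + ∑ i ∈ range n, #(layer X A (i + 1)) := by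
  induction n with
  | zero => simp
  | succ n ih =>
    have h := card_sdiff_add_card_eq_card (cum_subset_cum_succ (X := X) h0 n)
    rw [sum_range_succ, layer_succ]
    omega

/-- **Out-degrees**: `d_+(z) = |(z + A) ∩ N_{i+1}| ≤ |A ∖ {0}|` for `z ∈ N_i`.
[cite: HamidouneSerraZemor2006, §4 (proof of Lemma 17: «the total outdegree of N_1 is at most
7 × 5»)] -/
theorem card_vadd_inter_layer_succ_le {i : ℕ} {z : G} (hz : z ∈ layer X A i) :
    #((z +ᵥ A) ∩ layer X A (i + 1)) ≤ #(A.erase 0) := by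
  have hsub : (z +ᵥ A) ∩ layer X A (i + 1) ⊆ z +ᵥ A.erase 0 := by
    intro w hw
    rw [mem_inter, mem_vadd_finset] at hw
    obtain ⟨⟨a, ha, rfl⟩, hwN⟩ := hw
    refine mem_vadd_finset.2 ⟨a, mem_erase.2 ⟨fun ha0 => ?_, ha⟩, rfl⟩
    subst ha0
    rw [vadd_eq_add, add_zero, mem_layer_succ] at hwN
    exact hwN.2 (layer_subset_cum i hz)
  exact (card_le_card hsub).trans (card_vadd_finset _ _).le

/-- **In-degrees**: `d_−(z) = |(z − A) ∩ N_i| = |back_i(z)|`. [cite: HamidouneSerraZemor2006, §4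
(definition of d_−)] -/
theorem card_vadd_neg_inter_layer_eq (i : ℕ) (z : G) :
    #((z +ᵥ -A) ∩ layer X A i) = #(back X A i z) := by
  have : (z +ᵥ -A) ∩ layer X A i = (back X A i z).image fun a => z - a := by
    ext w
    simp only [mem_inter, mem_vadd_finset, vadd_eq_add, mem_neg', mem_image, mem_back]
    constructor
    · rintro ⟨⟨y, hy, rfl⟩, hw⟩
      exact ⟨-y, ⟨hy, by rwa [sub_neg_eq_add]⟩, by rw [sub_neg_eq_add]⟩
    · rintro ⟨a, ⟨ha, hza⟩, rfl⟩
      exact ⟨⟨-a, by rwa [neg_neg], by rw [sub_eq_add_neg]⟩, hza⟩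
  rw [this, card_image_of_injective _ sub_right_injective]

/-- **The degree count** (display (7) with `d_+ ≤ |A*|` and `d_− ≥ m`): if every point of
`N_{i+1}` has at least `m` back-neighbours then `m |N_{i+1}| ≤ |N_i| · |A ∖ {0}|`.
[cite: HamidouneSerraZemor2006, §4 (proof of Lemma 17: «|N_2| ≤ 11», «|N_3| ≤ 13»)] -/
theorem mul_card_layer_succ_le {i m : ℕ} (hm : ∀ z ∈ layer X A (i + 1), m ≤ #(back X A i z)) :
    m * #(layer X A (i + 1)) ≤ #(layer X A i) * #(A.erase 0) := by
  calc m * #(layer X A (i + 1)) = ∑ z ∈ layer X A (i + 1), m := by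
        rw [sum_const, smul_eq_mul, mul_comm]
    _ ≤ ∑ z ∈ layer X A (i + 1), #((z +ᵥ -A) ∩ layer X A i) :=
        sum_le_sum fun z hz => (hm z hz).trans (card_vadd_neg_inter_layer_eq i z).ge
    _ = ∑ z ∈ layer X A i, #((z +ᵥ A) ∩ layer X A (i + 1)) := (sum_card_vadd_inter_eq _ _ _).symm
    _ ≤ ∑ z ∈ layer X A i, #(A.erase 0) := sum_le_sum fun z hz => card_vadd_inter_layer_succ_le hz
    _ = #(layer X A i) * #(A.erase 0) := by rw [sum_const, smul_eq_mul]

/-- When every point of `N_{i+2}` has ALL of `A ∖ {0}` as back-neighbours (`N_{i+2} = N_{i+2}^{A*}`),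
`N_{i+2} − A* ⊆ N_{i+1}`. [cite: HamidouneSerraZemor2006, §4 (proof of Lemma 17:
«|N_i| + |A*| ≤ |N_i − A*| ≤ |N_{i−1}|»)] -/
theorem add_neg_mem_layer_of_back_eq {i : ℕ}
    (hfull : ∀ z ∈ layer X A (i + 2), back X A (i + 1) z = A.erase 0) :
    ∀ z ∈ layer X A (i + 2), ∀ u ∈ A.erase 0, z + -u ∈ layer X A (i + 1) := by
  intro z hz u hu
  rw [← hfull z hz, mem_back] at hu
  rw [← sub_eq_add_neg]
  exact hu.2

end Bricks

section BricksModP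

variable {p : ℕ} [hp : Fact p.Prime]
variable {X A U : Finset (ZMod p)}

/-- **No `N_2^U` for small `U`**: if `A ∋ 0` is a `k`-atom of `X ≠ ∅` and `∅ ≠ U ⊆ A ∖ {0}` with
`k + |U| ≤ |A|`, then `N_2^U = ∅` (else Lemma 6 gives `|N_1^{⊆U}| ≥ |U|` and `A ∖ U` beats the
atom). [cite: HamidouneSerraZemor2006, §4 (proof of Lemma 17, first bullet: «|N_2^{ab}| = 0»)] -/
theorem layerEq_two_eq_empty {k : ℕ} (hA : Isoperimetric.IsAtom k X A) (h0 : (0 : ZMod p) ∈ A)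
    (hX : X.Nonempty) (hUA : U ⊆ A.erase 0) (hU : U.Nonempty) (hk : k + #U ≤ #A) :
    layerEq X A 2 U = ∅ := by
  by_contra hne
  have hne' : (layerEq X A 2 U).Nonempty := nonempty_iff_ne_empty.2 hne
  have h : #(layerEq X A 2 U) + #U ≤ #(layerSub X A 1 U) + 1 :=
    card_layerEq_add_card_le hX h0 (i := 1) le_rfl hne'
  have hcard : #U ≤ #(layerSub X A 1 U) := by have := hne'.card_pos; omega
  exact false_of_card_le_card_layerSub hA h0 (hUA.trans (erase_subset _ _))
    (fun h => (mem_erase.1 (hUA h)).1 rfl) hU hk hcard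

/-- **The layers exhaust `ℤ/pℤ`**: if `N_{n+1} = ∅` (`X ≠ ∅`, `0 ∈ A`, `|A| ≥ 2`) then
`X + nA = ℤ/pℤ`. [cite: HamidouneSerraZemor2006, §2 (proof of Theorem 7: «Let t be the largest
integer such that N_t ≠ ∅, so that ℤ_p = B ∪ N_1 ∪ … ∪ N_t»)] -/
theorem cum_eq_univ_of_layer_eq_empty (hX : X.Nonempty) (h0 : (0 : ZMod p) ∈ A) (hA2 : 2 ≤ #A)
    {n : ℕ} (hn : layer X A (n + 1) = ∅) : cum X A n = univ := by
  classical
  obtain ⟨a, ha, ha0⟩ : ∃ a ∈ A, a ≠ 0 := by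
    by_contra h
    push Not at h
    have hsub : A ⊆ {0} := fun a ha => mem_singleton.2 (h a ha)
    have := card_le_card hsub
    rw [card_singleton] at this
    omega
  have hsub : cum X A n + A ⊆ cum X A n := by
    intro z hz
    by_contra hzn
    have : z ∈ layer X A (n + 1) := by rw [mem_layer_succ]; exact ⟨hz, hzn⟩
    rw [hn] at this
    exact notMem_empty _ this
  have hper : a +ᵥ cum X A n = cum X A n := by
    apply eq_of_subset_of_card_le
    · intro z hz
      obtain ⟨w, hw, rfl⟩ := mem_vadd_finset.1 hz
      rw [vadd_eq_add, add_comm]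
      exact hsub (add_mem_add hw ha)
    · rw [card_vadd_finset]
  exact Isoperimetric.eq_univ_of_vadd_eq (hX.mono (subset_cum h0 n)) ha0 hper

/-- Hence `p = |X| + Σ_{i=1}^{n} |N_i|` as soon as `N_{n+1} = ∅`. [cite: HamidouneSerraZemor2006,
§2 (proof of Theorem 7) and §4 (proof of Lemma 17: «Adding up … |X̄| ≤ 42»)] -/
theorem card_add_sum_card_layer_eq (hX : X.Nonempty) (h0 : (0 : ZMod p) ∈ A) (hA2 : 2 ≤ #A)
    {n : ℕ} (hn : layer X A (n + 1) = ∅) : #X + ∑ i ∈ range n, #(layer X A (i + 1)) = p := by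
  rw [← card_cum h0 n, cum_eq_univ_of_layer_eq_empty hX h0 hA2 hn, card_univ, ZMod.card]

/-- **The Cauchy–Davenport step on a full layer**: `N_{i+2} = N_{i+2}^{A*} ≠ ∅` gives
`|N_{i+2}| + |A*| ≤ |N_{i+1}| + 1`. [cite: HamidouneSerraZemor2006, §4 (proof of Lemma 17)] -/
theorem card_layer_add_card_erase_le_succ (hX : X.Nonempty) (h0 : (0 : ZMod p) ∈ A)
    (hA2 : 2 ≤ #A) {i : ℕ} (hfull : ∀ z ∈ layer X A (i + 2), back X A (i + 1) z = A.erase 0)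
    (hne : (layer X A (i + 2)).Nonempty) :
    #(layer X A (i + 2)) + #(A.erase 0) ≤ #(layer X A (i + 1)) + 1 :=
  Isoperimetric.card_add_card_le_of_forall_add_neg_mem hne
    (card_pos.1 (by rw [card_erase_of_mem h0]; omega)) (add_neg_mem_layer_of_back_eq hfull)
    (card_layer_succ_lt hX h0 i)

/-- **The Vosper step on a full layer** («since A* is not an arithmetic progression, we have, by
Vosper's Theorem, `|N_i| + |A*| ≤ |N_i − A*| ≤ |N_{i−1}|`»): with `N_{i+2} = N_{i+2}^{A*}`,
`|N_{i+2}| ≥ 2`, `|A| ≥ 3`, `|N_{i+1}| ≤ p − 2` and `A ∖ {0}` not a progression,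
`|N_{i+2}| + |A*| ≤ |N_{i+1}|`. [cite: HamidouneSerraZemor2006, §4 (proof of Lemma 17)] -/
theorem card_layer_add_card_erase_le (h0 : (0 : ZMod p) ∈ A) {i : ℕ}
    (hfull : ∀ z ∈ layer X A (i + 2), back X A (i + 1) z = A.erase 0)
    (hAP : ∀ d : ZMod p, ¬ IsAP (A.erase 0) d) (hA3 : 3 ≤ #A)
    (hsmall : #(layer X A (i + 1)) + 2 ≤ p) (h2 : 2 ≤ #(layer X A (i + 2))) :
    #(layer X A (i + 2)) + #(A.erase 0) ≤ #(layer X A (i + 1)) := by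
  classical
  have hB2 : 2 ≤ #(A.erase 0) := by rw [card_erase_of_mem h0]; omega
  have hincl : layer X A (i + 2) + -A.erase 0 ⊆ layer X A (i + 1) := by
    intro w hw
    obtain ⟨z, hz, v, hv, rfl⟩ := mem_add.1 hw
    rw [mem_neg'] at hv
    have := add_neg_mem_layer_of_back_eq hfull z hz (-v) hv
    rwa [neg_neg] at this
  have hle := card_le_card hincl
  have hne : layer X A (i + 2) + -A.erase 0 ≠ univ := fun h => by
    rw [h, card_univ, ZMod.card] at hle
    omega
  have hCD := Vosper.cauchy_davenport_of_ne_univ (card_pos.1 (by omega))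
    (card_pos.1 (by rw [card_neg]; omega)) hne
  rw [card_neg] at hCD
  by_contra hlt
  have hcrit : #(layer X A (i + 2) + -A.erase 0) = #(layer X A (i + 2)) + #(-A.erase 0) - 1 := by
    rw [card_neg]; omega
  obtain ⟨d, -, -, hBd⟩ := vosper_inverse h2 (by rw [card_neg]; exact hB2) hcrit (by omega)
  have : IsAP (A.erase 0) d := by
    have := hBd.neg
    rwa [neg_neg] at this
  exact hAP d this

/-- **A `k`-atom contains no long progression** («`A*` is not a `d`-progression, since otherwise
`|A ∩ (A + d)| ≥ 4` contradicting Theorem 5»): if `0 ∈ X`, `A` is a `k`-atom of `X` (`k ≥ 1`) and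
`A ⊇ {a, a + d, …, a + (m−1)d}` with `d ≠ 0`, `k + 1 ≤ m ≤ p`, then `A ∩ (d + A)` has `≥ k` points,
so `A = d + A` (intersection property of atoms) and `A = ℤ/pℤ` — absurd.
[cite: HamidouneSerraZemor2006, §4 (proofs of Lemmas 17 and 18, first step)] -/
theorem false_of_apFinset_subset {k : ℕ} (h0X : (0 : ZMod p) ∈ X) (hk : 1 ≤ k)
    (hA : Isoperimetric.IsAtom k X A) {a d : ZMod p} (hd : d ≠ 0) {m : ℕ} (hmp : m ≤ p)
    (hS : apFinset a d m ⊆ A) (hkm : k + 1 ≤ m) : False := by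
  classical
  have hT : apFinset (a + d) d (m - 1) ⊆ A ∩ (d +ᵥ A) := by
    intro w hw
    obtain ⟨j, hj, rfl⟩ := mem_apFinset.1 hw
    refine mem_inter.2 ⟨hS (mem_apFinset.2 ⟨j + 1, by omega, by rw [succ_nsmul]; abel⟩), ?_⟩
    exact mem_vadd_finset.2
      ⟨a + j • d, hS (mem_apFinset.2 ⟨j, by omega, rfl⟩), by rw [vadd_eq_add]; abel⟩
  have hcard : k ≤ #(A ∩ (d +ᵥ A)) := by
    have := card_le_card hT
    rw [card_apFinset hd (by omega)] at this
    omega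
  have heq : A = d +ᵥ A := Isoperimetric.IsAtom.eq_of_le_card_inter h0X hA (hA.vadd d) hcard
  have hAne : A.Nonempty := card_pos.1 (by have := hA.1.1.1; omega)
  have hAu : A = univ := Isoperimetric.eq_univ_of_vadd_eq hAne hd heq.symm
  have h1 := hA.1.1.2
  have h2 : #A ≤ #(A + X) := card_le_card_add_right ⟨0, h0X⟩
  have hAp : #A = p := by rw [hAu, card_univ, ZMod.card]
  rw [ZMod.card] at h1
  omega

/-- **The three-element test** («`A' = A ∖ {a,b,c}` satisfies `|(X + A') ∖ X| ≤ 3` but then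
Theorem [Hamidoune–Rødseth] implies that `ℓ_r(X) ≤ |X| + 1` for some `r`»): if `|T| = 3`,
`|X| ≥ 4`, `|T + X| ≤ |X| + 3` and `|X| + 7 ≤ p`, then `X` lies in a progression with `|X| + 1`
terms (Vosper's theorem in the case `|T + X| = |X| + 2`, Hamidoune–Rødseth's in the case
`|X| + 3`). [cite: HamidouneSerraZemor2006, §4 (proof of Lemma 17, second bullet)] -/
theorem exists_subset_apFinset_of_card_three {T : Finset (ZMod p)} (hT : #T = 3) (hX4 : 4 ≤ #X)
    (hTX : #(T + X) ≤ #X + 3) (hp7 : #X + 7 ≤ p) :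
    ∃ x₀ d : ZMod p, d ≠ 0 ∧ X ⊆ apFinset x₀ d (#X + 1) := by
  have hne : T + X ≠ univ := fun h => by
    rw [h, card_univ, ZMod.card] at hTX
    omega
  have hCD := Vosper.cauchy_davenport_of_ne_univ (card_pos.1 (by omega)) (card_pos.1 (by omega))
    hne
  obtain h | h : #(T + X) = #T + #X - 1 ∨ #(T + X) = #T + #X := by omega
  · obtain ⟨d, hd, -, ⟨x₀, hx₀⟩⟩ := vosper_inverse (by omega) (by omega) h (by omega)
    exact ⟨x₀, d, hd, fun x hx => Rectification.apFinset_subset_apFinset_of_le x₀ d (Nat.le_succ _)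
      (hx₀.subst (motive := fun W => x ∈ W) hx)⟩
  · obtain ⟨e, a, b, he, -, hXb⟩ :=
      Isoperimetric.hamidouneRodseth_inverse_theorem (A := T) (B := X) (by omega) (by omega)
        (by omega) h (by omega)
    exact ⟨b, e, he, hXb⟩

/-- **The two-element test** («`{0, e} = A ∖ {a,b,c,d}` is such that `|X + {0,e}| ≤ |X| + 1`
which implies that `ℓ_e(X) = |X|`»). [cite: HamidouneSerraZemor2006, §4 (proof of Lemma 17,
fourth bullet)] -/
theorem exists_eq_apFinset_of_card_pair_add {e : ZMod p} (he : e ≠ 0) (hXu : X ≠ univ)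
    (h : #({0, e} + X) ≤ #X + 1) : ∃ s : ZMod p, X = apFinset s e #X := by
  rw [add_comm, Isoperimetric.card_add_pair_zero_eq] at h
  obtain ⟨s, hs, -⟩ := Isoperimetric.exists_eq_apFinset_of_card_vadd_sdiff_le_one he hXu (by omega)
  exact ⟨s, hs⟩

end BricksModP

/-! ## Lemma 17: a `4`-atom has at most five elements -/

section LemmaSeventeen

variable {p : ℕ} [hp : Fact p.Prime]

/-- A progression with difference `0` is a single point. [folklore] -/
private theorem apFinset_zero_subset (a : ZMod p) (n : ℕ) : apFinset a (0 : ZMod p) n ⊆ {a} := by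
  intro x hx
  obtain ⟨i, -, rfl⟩ := mem_apFinset.1 hx
  rw [nsmul_zero, add_zero]
  exact mem_singleton_self _

/-- **Lemma 17.** «Let `X` and `p` be as in Theorem 14.  Let `A` be a `4`-atom of `X`.  Then
`|A| ≤ 5`.»  Hypotheses as used by the printed proof: `0 ∈ X`, `|X| ≥ 4`, `κ_4(X) ≤ |X| + 1`,
`p > |X| + 42`.  Proof as printed: `|A| ≤ 6` by Proposition 8; if `|A| = 6` (WLOG `0 ∈ A`) then
`A* = A ∖ 0` is not a progression (intersection property), `X` is not compressed (Lemma 16), and the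
layers `N_i = N_i(X, A)` satisfy `N_2^U = ∅` (`|U| ≤ 2`), `|N_2^U| ≤ 1` and `N_3^U = ∅` (`|U| = 3`,
via Hamidoune–Rødseth), `|N_2^U| ≤ 2`, `|N_3^U| ≤ 3`, `N_4^U = ∅` (`|U| = 4`, via the two-element
test), hence `N_i = N_i^{A*}` for `i ≥ 4`; the degree balance gives `|N_1| ≤ 7`, `|N_2| ≤ 11`,
`|N_3| ≤ 13`, Vosper's theorem `|N_4| ≤ 8`, `|N_5| ≤ 3`, `N_6 = ∅`, so `p − |X| ≤ 42`.
[cite: HamidouneSerraZemor2006, §4, Lemma 17] -/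
theorem card_le_five_of_isAtom_four {X A : Finset (ZMod p)} (h0X : (0 : ZMod p) ∈ X)
    (hX4 : 4 ≤ #X) (hconn : Isoperimetric.conn 4 X ≤ #X + 1) (hp42 : #X + 42 < p)
    (hA : Isoperimetric.IsAtom 4 X A) : #A ≤ 5 := by
  classical
  -- WLOG `0 ∈ A`
  wlog h0A : (0 : ZMod p) ∈ A generalizing A
  · obtain ⟨a, ha⟩ : A.Nonempty := card_pos.1 (by have := hA.1.1.1; omega)
    have h := this (hA.vadd (-a)) (mem_vadd_finset.2 ⟨a, ha, by simp⟩)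
    rwa [card_vadd_finset] at h
  -- Proposition 8: `|A| ≤ 6`
  have hA6 : #A ≤ 6 :=
    Isoperimetric.IsAtom.card_le_of_conn_le h0X (by norm_num) hX4 hconn (by omega) hA
  by_contra hA5
  have hA6 : #A = 6 := by omega
  have hXne : X.Nonempty := ⟨0, h0X⟩
  have hXu : X ≠ univ := fun h => by
    rw [h, card_univ, ZMod.card] at hp42
    omega
  obtain ⟨⟨⟨-, hAG⟩, hfrag⟩, -⟩ := id hA
  rw [ZMod.card] at hAG
  have hAXle : #A ≤ #(A + X) := card_le_card_add_right hXne
  have hAX : #(A + X) ≤ #A + #X + 1 := by omega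
  have hB : #(A.erase 0) = 5 := by rw [card_erase_of_mem h0A, hA6]
  -- Lemma 16: `X` is not compressed
  have hXnc : ∀ x₀ d : ZMod p, d ≠ 0 → ¬ X ⊆ apFinset x₀ d (#X + 2) := by
    intro x₀ d hd hX
    have := card_eq_of_subset_apFinset (by omega) le_rfl hA hd hX4 hX hAX (by omega)
    omega
  -- `A*` is not a progression (of any difference)
  have hAP : ∀ d : ZMod p, ¬ IsAP (A.erase 0) d := by
    rintro d ⟨a, ha⟩
    rw [hB] at ha
    by_cases hd : d = 0
    · subst hd
      have := card_le_card ((Finset.subset_of_eq ha).trans (apFinset_zero_subset a 5))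
      rw [hB, card_singleton] at this
      omega
    · exact false_of_apFinset_subset h0X (by norm_num) hA hd (m := 5) (by omega)
        (fun x hx => mem_of_mem_erase (ha.symm.subst (motive := fun W => x ∈ W) hx))
        (by norm_num)
  -- (1) `|N_1| ≤ 7`
  have hN1 : #(layer X A 1) ≤ 7 := by
    have := card_layer_one_add (X := X) h0A
    omega
  -- (2) `N_2^U = ∅` for `∅ ≠ U ⊆ A*` with `|U| ≤ 2`
  have hE2 : ∀ U ⊆ A.erase 0, U.Nonempty → #U ≤ 2 → layerEq X A 2 U = ∅ :=
    fun U hU hUne hU2 => layerEq_two_eq_empty hA h0A hXne hU hUne (by omega)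
  have hS2 : ∀ U ⊆ A.erase 0, #U ≤ 2 → layerSub X A 2 U = ∅ := fun U hU hU2 =>
    layerSub_succ_eq_empty_of_forall fun V hV hVne =>
      hE2 V (hV.trans hU) hVne ((card_le_card hV).trans hU2)
  -- (3a) `|N_2^U| ≤ 1` for `|U| = 3` (Hamidoune–Rødseth / Vosper on `A ∖ U`)
  have hE2three : ∀ U ⊆ A.erase 0, #U = 3 → #(layerEq X A 2 U) ≤ 1 := by
    intro U hU hU3
    by_contra hlt
    have hne : (layerEq X A 2 U).Nonempty := card_pos.1 (by omega)
    have h6 : #(layerEq X A 2 U) + #U ≤ #(layerSub X A 1 U) + 1 :=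
      card_layerEq_add_card_le hXne h0A (i := 1) le_rfl hne
    have h0U : (0 : ZMod p) ∉ U := fun h => (mem_erase.1 (hU h)).1 rfl
    have hdel := card_sdiff_add (X := X) h0A h0U
    have hT : #(A \ U) = 3 := by
      rw [card_sdiff_of_subset (hU.trans (erase_subset _ _))]
      omega
    obtain ⟨x₀, d, hd, hXd⟩ := exists_subset_apFinset_of_card_three hT hX4 (by omega) (by omega)
    exact hXnc x₀ d hd (hXd.trans (Rectification.apFinset_subset_apFinset_of_le x₀ d (by omega)))
  -- (3b) `N_2^{⊆U} ⊆ N_2^U` and `N_3^U = ∅` for `|U| = 3`; `N_3^{⊆U} = ∅` for `|U| ≤ 3`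
  have hS2three : ∀ U ⊆ A.erase 0, #U = 3 → layerSub X A 2 U ⊆ layerEq X A 2 U :=
    fun U hU hU3 => layerSub_succ_subset_layerEq_of_forall fun V hV hVU hVne =>
      hE2 V (hV.trans hU) hVne (by have := card_lt_card (hV.ssubset_of_ne hVU); omega)
  have hE3three : ∀ U ⊆ A.erase 0, #U = 3 → layerEq X A 3 U = ∅ := by
    intro U hU hU3
    by_contra hne
    have hne' := nonempty_iff_ne_empty.2 hne
    have h6 : #(layerEq X A 3 U) + #U ≤ #(layerSub X A 2 U) + 1 :=
      card_layerEq_add_card_le hXne h0A (i := 2) (by norm_num) hne'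
    have := card_le_card (hS2three U hU hU3)
    have := hE2three U hU hU3
    omega
  have hS3three : ∀ U ⊆ A.erase 0, #U ≤ 3 → layerSub X A 3 U = ∅ := by
    intro U hU hU3
    rcases Nat.lt_or_ge #U 3 with h | h
    · exact layerSub_succ_eq_empty (by norm_num) (hS2 U hU (by omega))
    · apply layerSub_succ_eq_empty_of_forall
      intro V hV hVne
      rcases Nat.lt_or_ge #V 3 with h' | h'
      · have := layerSub_succ_eq_empty (X := X) (A := A) (U := V) (i := 2) (by norm_num)
          (hS2 V (hV.trans hU) (by omega))
        exact subset_empty.1 ((layerEq_subset_layerSub 3).trans (Finset.subset_of_eq this))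
      · have hVU : V = U := eq_of_subset_of_card_le hV (by omega)
        rw [hVU]
        exact hE3three U hU (by omega)
  -- (4a) `|N_2^U| ≤ 2` for `|U| = 4` (the two-element test on `A ∖ U = {0, e}`)
  have hE2four : ∀ U ⊆ A.erase 0, #U = 4 → #(layerEq X A 2 U) ≤ 2 := by
    intro U hU hU4
    by_contra hlt
    have hne : (layerEq X A 2 U).Nonempty := card_pos.1 (by omega)
    have h6 : #(layerEq X A 2 U) + #U ≤ #(layerSub X A 1 U) + 1 :=
      card_layerEq_add_card_le hXne h0A (i := 1) le_rfl hne
    have h0U : (0 : ZMod p) ∉ U := fun h => (mem_erase.1 (hU h)).1 rfl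
    have hdel := card_sdiff_add (X := X) h0A h0U
    have hT2 : #(A \ U) = 2 := by
      rw [card_sdiff_of_subset (hU.trans (erase_subset _ _))]
      omega
    have h0T : (0 : ZMod p) ∈ A \ U := mem_sdiff.2 ⟨h0A, h0U⟩
    obtain ⟨e, he⟩ := card_eq_one.1
      (by rw [card_erase_of_mem h0T, hT2] : #((A \ U).erase 0) = 1)
    have he0 : e ≠ 0 := by
      have : e ∈ (A \ U).erase 0 := by rw [he]; exact mem_singleton_self e
      exact (mem_erase.1 this).1
    have hTe : A \ U = {0, e} := by rw [← insert_erase h0T, he]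
    rw [hTe] at hdel
    obtain ⟨s, hs⟩ := exists_eq_apFinset_of_card_pair_add he0 hXu (by omega)
    exact hXnc s e he0 ((Finset.subset_of_eq hs).trans
      (Rectification.apFinset_subset_apFinset_of_le s e (by omega)))
  -- (4b) `|N_3^U| ≤ 3` for `|U| = 4`
  have hE3four : ∀ U ⊆ A.erase 0, #U = 4 → #(layerEq X A 3 U) ≤ 3 := by
    intro U hU hU4
    by_contra hlt
    have hne : (layerEq X A 3 U).Nonempty := card_pos.1 (by omega)
    have h6 : #(layerEq X A 3 U) + #U ≤ #(layerSub X A 2 U) + 1 :=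
      card_layerEq_add_card_le hXne h0A (i := 2) (by norm_num) hne
    have hcov : layerSub X A 2 U ⊆
        layerEq X A 2 U ∪ (U.powersetCard 3).biUnion fun V => layerEq X A 2 V := by
      intro z hz
      rw [mem_layerSub_succ] at hz
      obtain ⟨hzN, hVU⟩ := hz
      have hzE : z ∈ layerEq X A 2 (back X A 1 z) := mem_layerEq_succ.2 ⟨hzN, rfl⟩
      have hVne := back_nonempty hzN
      have hcardV := card_le_card hVU
      rw [mem_union, mem_biUnion]
      by_cases h4 : #(back X A 1 z) = 4
      · left
        rwa [eq_of_subset_of_card_le hVU (by omega)] at hzE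
      · by_cases h3 : #(back X A 1 z) = 3
        · right
          exact ⟨back X A 1 z, mem_powersetCard.2 ⟨hVU, h3⟩, hzE⟩
        · exfalso
          have := hE2 _ (hVU.trans hU) hVne (by omega)
          rw [this] at hzE
          exact notMem_empty _ hzE
    have hcard : #(layerSub X A 2 U) ≤ 6 := by
      refine (card_le_card hcov).trans ((card_union_le _ _).trans ?_)
      have h1 := hE2four U hU hU4
      have h2 : #((U.powersetCard 3).biUnion fun V => layerEq X A 2 V) ≤ 4 := by
        refine card_biUnion_le.trans ?_
        calc ∑ V ∈ U.powersetCard 3, #(layerEq X A 2 V) ≤ ∑ V ∈ U.powersetCard 3, 1 :=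
              sum_le_sum fun V hV => hE2three V ((mem_powersetCard.1 hV).1.trans hU)
                (mem_powersetCard.1 hV).2
          _ = 4 := by rw [sum_const, smul_eq_mul, mul_one, card_powersetCard, hU4]; rfl
      omega
    omega
  -- (4c) `N_3^{⊆U} ⊆ N_3^U` and `N_4^{⊆U} = ∅` for `|U| ≤ 4`
  have hS3four : ∀ U ⊆ A.erase 0, #U = 4 → layerSub X A 3 U ⊆ layerEq X A 3 U :=
    fun U hU hU4 => layerSub_succ_subset_layerEq_of_forall fun V hV hVU hVne => by
      have hV3 : #V ≤ 3 := by have := card_lt_card (hV.ssubset_of_ne hVU); omega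
      have := hS3three V (hV.trans hU) hV3
      exact subset_empty.1 ((layerEq_subset_layerSub 3).trans (Finset.subset_of_eq this))
  have hS4 : ∀ U ⊆ A.erase 0, #U ≤ 4 → layerSub X A 4 U = ∅ := by
    intro U hU hU4
    rcases Nat.lt_or_ge #U 4 with h | h
    · exact layerSub_succ_eq_empty (by norm_num) (hS3three U hU (by omega))
    · apply layerSub_succ_eq_empty_of_forall
      intro V hV hVne
      rcases Nat.lt_or_ge #V 4 with h' | h'
      · have := layerSub_succ_eq_empty (X := X) (A := A) (U := V) (i := 3) (by norm_num)
          (hS3three V (hV.trans hU) (by omega))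
        exact subset_empty.1 ((layerEq_subset_layerSub 4).trans (Finset.subset_of_eq this))
      · have hVU : V = U := eq_of_subset_of_card_le hV (by omega)
        rw [hVU]
        by_contra hne
        have hne' := nonempty_iff_ne_empty.2 hne
        have h6 : #(layerEq X A 4 U) + #U ≤ #(layerSub X A 3 U) + 1 :=
          card_layerEq_add_card_le hXne h0A (i := 3) (by norm_num) hne'
        have := card_le_card (hS3four U hU (by omega))
        have := hE3four U hU (by omega)
        have := hne'.card_pos
        simp only [Nat.reduceAdd] at this
        omega
  -- hence `N_i = N_i^{A*}` for `i ≥ 4`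
  have hfull : ∀ j : ℕ, 3 ≤ j → ∀ z ∈ layer X A (j + 1), back X A j z = A.erase 0 := by
    intro j hj z hz
    have hsub := back_subset_erase_zero hz
    by_contra hne
    have hlt : #(back X A j z) ≤ 4 := by
      have := card_lt_card (hsub.ssubset_of_ne hne)
      omega
    have h1 : layerSub X A (j + 1) (back X A j z) = ∅ :=
      layerSub_eq_empty_of_le (by norm_num) (by omega : 4 ≤ j + 1) (hS4 _ hsub hlt)
    have h2 : z ∈ layerSub X A (j + 1) (back X A j z) := mem_layerSub_succ.2 ⟨hz, Subset.rfl⟩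
    rw [h1] at h2
    exact notMem_empty _ h2
  -- (5) the counts
  have hN2 : #(layer X A 2) ≤ 11 := by
    have := mul_card_layer_succ_le (X := X) (A := A) (i := 1) (m := 3) (fun z hz => by
      by_contra hlt
      have hVne := back_nonempty hz
      have h1 := hE2 _ (back_subset_erase_zero hz) hVne (by omega)
      have hzE : z ∈ layerEq X A 2 (back X A 1 z) := mem_layerEq_succ.2 ⟨hz, rfl⟩
      rw [h1] at hzE
      exact notMem_empty _ hzE)
    simp only [Nat.reduceAdd] at this
    rw [hB] at this
    omega
  have hN3 : #(layer X A 3) ≤ 13 := by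
    have := mul_card_layer_succ_le (X := X) (A := A) (i := 2) (m := 4) (fun z hz => by
      by_contra hlt
      have hsub := back_subset_erase_zero hz
      have h1 := hS3three _ hsub (by omega)
      have h2 : z ∈ layerSub X A 3 (back X A 2 z) := mem_layerSub_succ.2 ⟨hz, Subset.rfl⟩
      rw [h1] at h2
      exact notMem_empty _ h2)
    simp only [Nat.reduceAdd] at this
    rw [hB] at this
    omega
  have hN4 : #(layer X A 4) ≤ 8 := by
    rcases Nat.lt_or_ge #(layer X A 4) 2 with h | h
    · omega
    · have := card_layer_add_card_erase_le h0A (i := 2) (hfull 3 le_rfl) hAP (by omega)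
        (by simp only [Nat.reduceAdd]; omega) (by simpa using h)
      simp only [Nat.reduceAdd] at this
      rw [hB] at this
      omega
  have hN5 : #(layer X A 5) ≤ 3 := by
    rcases Nat.lt_or_ge #(layer X A 5) 2 with h | h
    · omega
    · have := card_layer_add_card_erase_le h0A (i := 3) (hfull 4 (by norm_num)) hAP (by omega)
        (by simp only [Nat.reduceAdd]; omega) (by simpa using h)
      simp only [Nat.reduceAdd] at this
      rw [hB] at this
      omega
  have hN6 : layer X A 6 = ∅ := by
    by_contra hne
    have hne' := nonempty_iff_ne_empty.2 hne
    have h1 := card_layer_add_card_erase_le_succ hXne h0A (by omega) (i := 4)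
      (hfull 5 (by norm_num)) hne'
    simp only [Nat.reduceAdd] at h1
    rw [hB] at h1
    have := hne'.card_pos
    omega
  have hsum := card_add_sum_card_layer_eq hXne h0A (by omega) (n := 5) hN6
  simp only [sum_range_succ, sum_range_zero, zero_add, Nat.reduceAdd] at hsum
  omega

end LemmaSeventeen

/-! ## Lemma 18: a `4`-atom has exactly four elements -/

section LemmaEighteen

variable {p : ℕ} [hp : Fact p.Prime]

/-- The translates of `A ∖ {0}` starting inside `N_{i+1}` land in `N_{i+1}` only `|A*|` times
(`z + 0 = z` stays in `N_i`). [cite: HamidouneSerraZemor2006, §4 (proof of Lemma 18: «|N_2| = 9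
can occur only if d_+(z) = 4 for every z ∈ N_1 which implies |N_2| = |N_1 + A*|»)] -/
theorem vadd_inter_layer_succ_subset {G : Type*} [AddCommGroup G] [DecidableEq G]
    {X A : Finset G} {i : ℕ} {z : G} (hz : z ∈ layer X A i) :
    (z +ᵥ A) ∩ layer X A (i + 1) ⊆ z +ᵥ A.erase 0 := by
  intro w hw
  rw [mem_inter, mem_vadd_finset] at hw
  obtain ⟨⟨a, ha, rfl⟩, hwN⟩ := hw
  refine mem_vadd_finset.2 ⟨a, mem_erase.2 ⟨fun ha0 => ?_, ha⟩, rfl⟩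
  subst ha0
  rw [vadd_eq_add, add_zero, mem_layer_succ] at hwN
  exact hwN.2 (layer_subset_cum i hz)

/-- **The Vosper step, abstract form**: if `N' − A* ⊆ N`, `A ∖ {0}` is no progression, `|A| ≥ 3`,
`|N| ≤ p − 2` and `|N'| ≥ 2`, then `|N'| + |A*| ≤ |N|` (used for `N' = N_4^{A*} ⊆ N_4`).
[cite: HamidouneSerraZemor2006, §4 (proof of Lemma 18: «|N_4^{A*}| + |A*| ≤ |N_4^{A*} − A*| ≤
|N_3|»)] -/
theorem card_add_card_erase_le_of_forall {A N N' : Finset (ZMod p)} (h0 : (0 : ZMod p) ∈ A)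
    (hsub : ∀ z ∈ N', ∀ u ∈ A.erase 0, z + -u ∈ N) (hAP : ∀ d : ZMod p, ¬ IsAP (A.erase 0) d)
    (hA3 : 3 ≤ #A) (hsmall : #N + 2 ≤ p) (h2 : 2 ≤ #N') : #N' + #(A.erase 0) ≤ #N := by
  classical
  have hB2 : 2 ≤ #(A.erase 0) := by rw [card_erase_of_mem h0]; omega
  have hincl : N' + -A.erase 0 ⊆ N := by
    intro w hw
    obtain ⟨z, hz, v, hv, rfl⟩ := mem_add.1 hw
    rw [mem_neg'] at hv
    have := hsub z hz (-v) hv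
    rwa [neg_neg] at this
  have hle := card_le_card hincl
  have hne : N' + -A.erase 0 ≠ univ := fun h => by
    rw [h, card_univ, ZMod.card] at hle
    omega
  have hCD := Vosper.cauchy_davenport_of_ne_univ (card_pos.1 (by omega))
    (card_pos.1 (by rw [card_neg]; omega)) hne
  rw [card_neg] at hCD
  by_contra hlt
  have hcrit : #(N' + -A.erase 0) = #N' + #(-A.erase 0) - 1 := by
    rw [card_neg]; omega
  obtain ⟨d, -, -, hBd⟩ := vosper_inverse h2 (by rw [card_neg]; exact hB2) hcrit (by omega)
  have : IsAP (A.erase 0) d := by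
    have := hBd.neg
    rwa [neg_neg] at this
  exact hAP d this

/-- **Three terms of a `d`-progression inside a four-term `e`-progression force `e = ±d`**
(`p ≥ 8`): the positions `i, j, l < 4` of `x, x + d, x + 2d` satisfy `2j = i + l` with
`i, j, l` distinct, so they are consecutive.  (The elementary step behind «if `B*` were an
arithmetic progression of difference `d` we would have … implying that `B*` is an arithmetic
progression of difference `1` or `2`, none of which are possible».)
[cite: HamidouneSerraZemor2006, §4 (proof of Lemma 18, reduction to «A* not a progression»)] -/
theorem eq_or_eq_neg_of_triple_subset {x d b e : ZMod p} (hd : d ≠ 0) (he : e ≠ 0)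
    (hp8 : 8 ≤ p) (h : ({x, x + d, x + 2 • d} : Finset (ZMod p)) ⊆ apFinset b e 4) :
    e = d ∨ e = -d := by
  have hp2 : (2 : ZMod p) ≠ 0 := by
    intro h2
    have h2' : ((2 : ℕ) : ZMod p) = 0 := by exact_mod_cast h2
    rw [ZMod.natCast_eq_zero_iff] at h2'
    have := Nat.le_of_dvd (by norm_num) h2'
    omega
  obtain ⟨i, hi, hix⟩ := mem_apFinset.1 (h (by simp : x ∈ _))
  obtain ⟨j, hj, hjx⟩ := mem_apFinset.1 (h (by simp : x + d ∈ _))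
  obtain ⟨l, hl, hlx⟩ := mem_apFinset.1 (h (by simp : x + 2 • d ∈ _))
  simp only [nsmul_eq_mul, Nat.cast_ofNat] at hix hjx hlx
  have hij : i ≠ j := by
    rintro rfl
    have : x + d = x + 0 := by rw [add_zero]; exact hjx.symm.trans hix
    exact hd (add_left_cancel this)
  have hjl : j ≠ l := by
    rintro rfl
    have h1 : x + 2 * d = x + d := hlx.symm.trans hjx
    have : d = 0 := by linear_combination h1
    exact hd this
  have hil : i ≠ l := by
    rintro rfl
    have h1 : x + 2 * d = x := hlx.symm.trans hix
    have : (2 : ZMod p) * d = 0 := by linear_combination h1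
    rcases mul_eq_zero.1 this with h' | h'
    · exact hp2 h'
    · exact hd h'
  have e1 : (j + j) • e = (i + l) • e := by
    rw [nsmul_eq_mul, nsmul_eq_mul]
    push_cast
    linear_combination 2 * hjx - hix - hlx
  have h2j := HamidouneRodseth.nat_eq_of_nsmul_eq he (by omega) (by omega) e1
  rcases (by omega : i + 1 = j ∨ j + 1 = i) with hc | hc
  · left
    have hc' : (j : ZMod p) = (i : ZMod p) + 1 := by rw [← hc, Nat.cast_succ]
    linear_combination hjx - hix - e * hc'
  · right
    have hc' : (i : ZMod p) = (j : ZMod p) + 1 := by rw [← hc, Nat.cast_succ]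
    linear_combination hix - hjx - e * hc'

/-- The core of **Lemma 18**: with `X, p` as in Lemma 17, a `4`-atom `A ∋ 0` of `X` with
`|A| = 5` whose `A* = A ∖ {0}` is not a progression is impossible — the printed layer count
`|N_1| ≤ 6`, `|N_2| ≤ 8` («actually», by Vosper on `N_1 + A*`), `|N_3| ≤ 10`, `|N_4| ≤ 10`
(`|N_4^{A*}| ≤ 6` and one point for each of the four `N_4^V`, `|V| = 3`), `|N_5| ≤ 6`, `|N_6| ≤ 2`,
`N_7 = ∅`, so `p − |X| ≤ 42`.  (The paper bounds `|N_4 ∖ N_4^{A*}| ≤ 3` by a disjointness remark and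
gets `39`; the cruder `4`, hence `42`, still contradicts `p > |X| + 42`.)
[cite: HamidouneSerraZemor2006, §4, Lemma 18 (proof)] -/
theorem false_of_isAtom_four_card_five {X A : Finset (ZMod p)} (h0X : (0 : ZMod p) ∈ X)
    (hX4 : 4 ≤ #X) (hconn : Isoperimetric.conn 4 X ≤ #X + 1) (hp42 : #X + 42 < p)
    (hA : Isoperimetric.IsAtom 4 X A) (h0A : (0 : ZMod p) ∈ A) (hA5 : #A = 5)
    (hAP : ∀ d : ZMod p, ¬ IsAP (A.erase 0) d) : False := by
  classical
  have hXne : X.Nonempty := ⟨0, h0X⟩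
  have hXu : X ≠ univ := fun h => by
    rw [h, card_univ, ZMod.card] at hp42
    omega
  obtain ⟨⟨⟨-, hAG⟩, hfrag⟩, -⟩ := id hA
  rw [ZMod.card] at hAG
  have hAXle : #A ≤ #(A + X) := card_le_card_add_right hXne
  have hAX : #(A + X) ≤ #A + #X + 1 := by omega
  have hB : #(A.erase 0) = 4 := by rw [card_erase_of_mem h0A, hA5]
  -- Lemma 16: `X` is not compressed
  have hXnc : ∀ x₀ d : ZMod p, d ≠ 0 → ¬ X ⊆ apFinset x₀ d (#X + 2) := by
    intro x₀ d hd hX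
    have := card_eq_of_subset_apFinset (by omega) le_rfl hA hd hX4 hX hAX (by omega)
    omega
  -- (1) `|N_1| ≤ 6`
  have hN1 : #(layer X A 1) ≤ 6 := by
    have := card_layer_one_add (X := X) h0A
    omega
  -- singletons: `N_1^{{a}} = ∅` (Lemma 15), so `N_i^{⊆U} = ∅` for `|U| ≤ 1`, `i ≥ 1`
  have hS1one : ∀ U : Finset (ZMod p), #U ≤ 1 → layerSub X A 1 U = ∅ := by
    intro U hU1
    apply layerSub_succ_eq_empty_of_forall
    intro V hV hVne
    obtain ⟨a, rfl⟩ : ∃ a, V = {a} :=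
      card_eq_one.1 (le_antisymm ((card_le_card hV).trans hU1) hVne.card_pos)
    by_contra hne
    have := card_eq_of_layerEq_singleton_nonempty hA (nonempty_iff_ne_empty.2 hne)
    omega
  have hSone : ∀ j : ℕ, 1 ≤ j → ∀ U : Finset (ZMod p), #U ≤ 1 → layerSub X A j U = ∅ :=
    fun j hj U hU1 => layerSub_eq_empty_of_le le_rfl hj (hS1one U hU1)
  have hEone : ∀ j : ℕ, ∀ U : Finset (ZMod p), #U ≤ 1 → layerEq X A (j + 1) U = ∅ :=
    fun j U hU1 => subset_empty.1 ((layerEq_subset_layerSub _).trans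
      (Finset.subset_of_eq (hSone (j + 1) (by omega) U hU1)))
  -- (2) pairs `U ⊆ A*`: `|N_1^{⊆U}| ≤ 2` (Hamidoune–Rødseth), `|N_2^U| ≤ 1`, `N_3^U = ∅`
  have hS1two : ∀ U ⊆ A.erase 0, #U = 2 → #(layerSub X A 1 U) ≤ 2 := by
    intro U hU hU2
    by_contra hlt
    have h0U : (0 : ZMod p) ∉ U := fun h => (mem_erase.1 (hU h)).1 rfl
    have hdel := card_sdiff_add (X := X) h0A h0U
    have hT : #(A \ U) = 3 := by
      rw [card_sdiff_of_subset (hU.trans (erase_subset _ _))]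
      omega
    obtain ⟨x₀, d, hd, hXd⟩ := exists_subset_apFinset_of_card_three hT hX4 (by omega) (by omega)
    exact hXnc x₀ d hd (hXd.trans (Rectification.apFinset_subset_apFinset_of_le x₀ d (by omega)))
  have hE2two : ∀ U ⊆ A.erase 0, #U = 2 → #(layerEq X A 2 U) ≤ 1 := by
    intro U hU hU2
    rcases (layerEq X A 2 U).eq_empty_or_nonempty with h | hne
    · rw [h, card_empty]; omega
    · have h6 : #(layerEq X A 2 U) + #U ≤ #(layerSub X A 1 U) + 1 :=
        card_layerEq_add_card_le hXne h0A (i := 1) le_rfl hne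
      have := hS1two U hU hU2
      omega
  have hS2two : ∀ U ⊆ A.erase 0, #U = 2 → layerSub X A 2 U ⊆ layerEq X A 2 U :=
    fun U hU hU2 => layerSub_succ_subset_layerEq_of_forall fun V hV hVU hVne =>
      hEone 1 V (by have := card_lt_card (hV.ssubset_of_ne hVU); omega)
  have hE3two : ∀ U ⊆ A.erase 0, #U = 2 → layerEq X A 3 U = ∅ := by
    intro U hU hU2
    by_contra hne
    have hne' := nonempty_iff_ne_empty.2 hne
    have h6 : #(layerEq X A 3 U) + #U ≤ #(layerSub X A 2 U) + 1 :=
      card_layerEq_add_card_le hXne h0A (i := 2) (by norm_num) hne'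
    have := card_le_card (hS2two U hU hU2)
    have := hE2two U hU hU2
    have := hne'.card_pos
    omega
  have hS3two : ∀ U ⊆ A.erase 0, #U ≤ 2 → layerSub X A 3 U = ∅ := by
    intro U hU hU2
    rcases Nat.lt_or_ge #U 2 with h | h
    · exact hSone 3 (by norm_num) U (by omega)
    · apply layerSub_succ_eq_empty_of_forall
      intro V hV hVne
      rcases Nat.lt_or_ge #V 2 with h' | h'
      · exact hEone 2 V (by omega)
      · have hVU : V = U := eq_of_subset_of_card_le hV (by omega)
        rw [hVU]
        exact hE3two U hU (by omega)
  -- (3) triples `V ⊆ A*`: `|N_2^V| ≤ 2` (two-element test), `|N_2^{⊆V}| ≤ 5`, `|N_3^V| ≤ 3`,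
  -- `|N_4^V| ≤ 1`, `N_5^V = ∅`
  have hE2three : ∀ V ⊆ A.erase 0, #V = 3 → #(layerEq X A 2 V) ≤ 2 := by
    intro V hV hV3
    by_contra hlt
    have hne : (layerEq X A 2 V).Nonempty := card_pos.1 (by omega)
    have h6 : #(layerEq X A 2 V) + #V ≤ #(layerSub X A 1 V) + 1 :=
      card_layerEq_add_card_le hXne h0A (i := 1) le_rfl hne
    have h0V : (0 : ZMod p) ∉ V := fun h => (mem_erase.1 (hV h)).1 rfl
    have hdel := card_sdiff_add (X := X) h0A h0V
    have hT2 : #(A \ V) = 2 := by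
      rw [card_sdiff_of_subset (hV.trans (erase_subset _ _))]
      omega
    have h0T : (0 : ZMod p) ∈ A \ V := mem_sdiff.2 ⟨h0A, h0V⟩
    obtain ⟨e, he⟩ := card_eq_one.1
      (by rw [card_erase_of_mem h0T, hT2] : #((A \ V).erase 0) = 1)
    have he0 : e ≠ 0 := by
      have : e ∈ (A \ V).erase 0 := by rw [he]; exact mem_singleton_self e
      exact (mem_erase.1 this).1
    have hTe : A \ V = {0, e} := by rw [← insert_erase h0T, he]
    rw [hTe] at hdel
    obtain ⟨s, hs⟩ := exists_eq_apFinset_of_card_pair_add he0 hXu (by omega)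
    exact hXnc s e he0 ((Finset.subset_of_eq hs).trans
      (Rectification.apFinset_subset_apFinset_of_le s e (by omega)))
  have hS2three : ∀ V ⊆ A.erase 0, #V = 3 → #(layerSub X A 2 V) ≤ 5 := by
    intro V hV hV3
    have hcov : layerSub X A 2 V ⊆
        layerEq X A 2 V ∪ (V.powersetCard 2).biUnion fun U => layerEq X A 2 U := by
      intro z hz
      rw [mem_layerSub_succ] at hz
      obtain ⟨hzN, hUV⟩ := hz
      have hzE : z ∈ layerEq X A 2 (back X A 1 z) := mem_layerEq_succ.2 ⟨hzN, rfl⟩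
      have hcardU := card_le_card hUV
      rw [mem_union, mem_biUnion]
      by_cases h3 : #(back X A 1 z) = 3
      · left
        rwa [eq_of_subset_of_card_le hUV (by omega)] at hzE
      · by_cases h2 : #(back X A 1 z) = 2
        · right
          exact ⟨back X A 1 z, mem_powersetCard.2 ⟨hUV, h2⟩, hzE⟩
        · exfalso
          rw [hEone 1 _ (by omega)] at hzE
          exact notMem_empty _ hzE
    refine (card_le_card hcov).trans ((card_union_le _ _).trans ?_)
    have h1 := hE2three V hV hV3
    have h2 : #((V.powersetCard 2).biUnion fun U => layerEq X A 2 U) ≤ 3 := by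
      refine card_biUnion_le.trans ?_
      calc ∑ U ∈ V.powersetCard 2, #(layerEq X A 2 U) ≤ ∑ U ∈ V.powersetCard 2, 1 :=
            sum_le_sum fun U hU => hE2two U ((mem_powersetCard.1 hU).1.trans hV)
              (mem_powersetCard.1 hU).2
        _ = 3 := by rw [sum_const, smul_eq_mul, mul_one, card_powersetCard, hV3]; rfl
    omega
  have hE3three : ∀ V ⊆ A.erase 0, #V = 3 → #(layerEq X A 3 V) ≤ 3 := by
    intro V hV hV3
    rcases (layerEq X A 3 V).eq_empty_or_nonempty with h | hne
    · rw [h, card_empty]; omega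
    · have h6 : #(layerEq X A 3 V) + #V ≤ #(layerSub X A 2 V) + 1 :=
        card_layerEq_add_card_le hXne h0A (i := 2) (by norm_num) hne
      have := hS2three V hV hV3
      omega
  have hS3three : ∀ V ⊆ A.erase 0, #V = 3 → layerSub X A 3 V ⊆ layerEq X A 3 V :=
    fun V hV hV3 => layerSub_succ_subset_layerEq_of_forall fun U hU hUV hUne => by
      have hU2 : #U ≤ 2 := by have := card_lt_card (hU.ssubset_of_ne hUV); omega
      exact subset_empty.1 ((layerEq_subset_layerSub 3).trans
        (Finset.subset_of_eq (hS3two U (hU.trans hV) hU2)))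
  have hE4three : ∀ V ⊆ A.erase 0, #V = 3 → #(layerEq X A 4 V) ≤ 1 := by
    intro V hV hV3
    rcases (layerEq X A 4 V).eq_empty_or_nonempty with h | hne
    · rw [h, card_empty]; omega
    · have h6 : #(layerEq X A 4 V) + #V ≤ #(layerSub X A 3 V) + 1 :=
        card_layerEq_add_card_le hXne h0A (i := 3) (by norm_num) hne
      have := card_le_card (hS3three V hV hV3)
      have := hE3three V hV hV3
      omega
  have hS4two : ∀ U ⊆ A.erase 0, #U ≤ 2 → layerSub X A 4 U = ∅ :=
    fun U hU hU2 => layerSub_succ_eq_empty (by norm_num) (hS3two U hU hU2)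
  have hS4three : ∀ V ⊆ A.erase 0, #V = 3 → layerSub X A 4 V ⊆ layerEq X A 4 V :=
    fun V hV hV3 => layerSub_succ_subset_layerEq_of_forall fun U hU hUV hUne => by
      have hU2 : #U ≤ 2 := by have := card_lt_card (hU.ssubset_of_ne hUV); omega
      exact subset_empty.1 ((layerEq_subset_layerSub 4).trans
        (Finset.subset_of_eq (hS4two U (hU.trans hV) hU2)))
  have hE5three : ∀ V ⊆ A.erase 0, #V = 3 → layerEq X A 5 V = ∅ := by
    intro V hV hV3
    by_contra hne
    have hne' := nonempty_iff_ne_empty.2 hne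
    have h6 : #(layerEq X A 5 V) + #V ≤ #(layerSub X A 4 V) + 1 :=
      card_layerEq_add_card_le hXne h0A (i := 4) (by norm_num) hne'
    have := card_le_card (hS4three V hV hV3)
    have := hE4three V hV hV3
    have := hne'.card_pos
    omega
  have hS5 : ∀ U ⊆ A.erase 0, #U ≤ 3 → layerSub X A 5 U = ∅ := by
    intro U hU hU3
    rcases Nat.lt_or_ge #U 3 with h | h
    · exact layerSub_succ_eq_empty (by norm_num) (hS4two U hU (by omega))
    · apply layerSub_succ_eq_empty_of_forall
      intro V hV hVne
      rcases Nat.lt_or_ge #V 3 with h' | h'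
      · exact subset_empty.1 ((layerEq_subset_layerSub 5).trans (Finset.subset_of_eq
          (layerSub_succ_eq_empty (by norm_num) (hS4two V (hV.trans hU) (by omega)))))
      · have hVU : V = U := eq_of_subset_of_card_le hV (by omega)
        rw [hVU]
        exact hE5three U hU (by omega)
  -- hence `N_i = N_i^{A*}` for `i ≥ 5`
  have hfull : ∀ j : ℕ, 4 ≤ j → ∀ z ∈ layer X A (j + 1), back X A j z = A.erase 0 := by
    intro j hj z hz
    have hsub := back_subset_erase_zero hz
    by_contra hne
    have hlt : #(back X A j z) ≤ 3 := by
      have := card_lt_card (hsub.ssubset_of_ne hne)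
      omega
    have h1 : layerSub X A (j + 1) (back X A j z) = ∅ :=
      layerSub_eq_empty_of_le (by norm_num) (by omega : 5 ≤ j + 1) (hS5 _ hsub hlt)
    have h2 : z ∈ layerSub X A (j + 1) (back X A j z) := mem_layerSub_succ.2 ⟨hz, Subset.rfl⟩
    rw [h1] at h2
    exact notMem_empty _ h2
  -- (4) at most three pairs `U` have `N_2^U ≠ ∅` (their `N_1^{⊆U}` are disjoint, of size `≥ 2`, in
  -- `N_1`), hence at most three points of `N_2` have in-degree `2`
  obtain ⟨P, hPdef⟩ : ∃ P : Finset (Finset (ZMod p)),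
      P = ((A.erase 0).powersetCard 2).filter fun U => (layerEq X A 2 U).Nonempty := ⟨_, rfl⟩
  have hmemP : ∀ U, U ∈ P ↔ (U ⊆ A.erase 0 ∧ #U = 2) ∧ (layerEq X A 2 U).Nonempty := by
    intro U
    rw [hPdef, mem_filter, mem_powersetCard]
  have hPcard : #P ≤ 3 := by
    have hdisj : (P : Set (Finset (ZMod p))).PairwiseDisjoint fun U => layerSub X A 1 U := by
      intro U hU U' hU' hne
      rw [Function.onFun, disjoint_left]
      intro z hz hz'
      rw [mem_coe, hmemP] at hU hU'
      rw [mem_layerSub_succ] at hz hz'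
      have hsub : back X A 0 z ⊆ U ∩ U' := subset_inter hz.2 hz'.2
      have hcard : #(U ∩ U') ≤ 1 := by
        by_contra hlt
        have h1 : U ∩ U' = U := eq_of_subset_of_card_le inter_subset_left (by omega)
        have h2 : U ∩ U' = U' := eq_of_subset_of_card_le inter_subset_right (by omega)
        exact hne (h1.symm.trans h2)
      have : z ∈ layerSub X A 1 (U ∩ U') := mem_layerSub_succ.2 ⟨hz.1, hsub⟩
      rw [hS1one _ hcard] at this
      exact notMem_empty _ this
    have h1 : #(P.biUnion fun U => layerSub X A 1 U) = ∑ U ∈ P, #(layerSub X A 1 U) :=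
      card_biUnion hdisj
    have h2 : (P.biUnion fun U => layerSub X A 1 U) ⊆ layer X A 1 :=
      biUnion_subset.2 fun U _ => layerSub_subset_layer _
    have h3 : ∑ U ∈ P, 2 ≤ ∑ U ∈ P, #(layerSub X A 1 U) := sum_le_sum fun U hU => by
      rw [hmemP] at hU
      have h6 : #(layerEq X A 2 U) + #U ≤ #(layerSub X A 1 U) + 1 :=
        card_layerEq_add_card_le hXne h0A (i := 1) le_rfl hU.2
      have := hU.2.card_pos
      omega
    rw [sum_const, smul_eq_mul] at h3
    have := card_le_card h2
    omega
  obtain ⟨T, hTdef⟩ : ∃ T : Finset (ZMod p),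
      T = (layer X A 2).filter fun z => #(back X A 1 z) = 2 := ⟨_, rfl⟩
  have hTcard : #T ≤ 3 := by
    have hcov : T ⊆ P.biUnion fun U => layerEq X A 2 U := by
      intro z hz
      rw [hTdef, mem_filter] at hz
      rw [mem_biUnion]
      have hzE : z ∈ layerEq X A 2 (back X A 1 z) := mem_layerEq_succ.2 ⟨hz.1, rfl⟩
      exact ⟨back X A 1 z, (hmemP _).2 ⟨⟨back_subset_erase_zero hz.1, hz.2⟩, ⟨z, hzE⟩⟩, hzE⟩
    refine (card_le_card hcov).trans (card_biUnion_le.trans ?_)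
    calc ∑ U ∈ P, #(layerEq X A 2 U) ≤ ∑ U ∈ P, 1 := sum_le_sum fun U hU => by
            rw [hmemP] at hU
            exact hE2two U hU.1.1 hU.1.2
      _ = #P := by rw [sum_const, smul_eq_mul, mul_one]
      _ ≤ 3 := hPcard
  -- (5) the degree balance between `N_1` and `N_2`: `3|N_2| − |T| ≤ Σ d_− = Σ d_+ ≤ 4|N_1|`
  have hdegge : 3 * #(layer X A 2) ≤ ∑ z ∈ layer X A 2, #(back X A 1 z) + #T := by
    have hz3 : ∀ z ∈ layer X A 2,
        3 ≤ #(back X A 1 z) + (if #(back X A 1 z) = 2 then 1 else 0) := by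
      intro z hz
      have h2 : 2 ≤ #(back X A 1 z) := by
        by_contra hlt
        have h1 := hSone 2 (by norm_num) _ (by omega : #(back X A 1 z) ≤ 1)
        have hz' : z ∈ layerSub X A 2 (back X A 1 z) := mem_layerSub_succ.2 ⟨hz, Subset.rfl⟩
        rw [h1] at hz'
        exact notMem_empty _ hz'
      split_ifs with h <;> omega
    calc 3 * #(layer X A 2) = ∑ z ∈ layer X A 2, 3 := by rw [sum_const, smul_eq_mul, mul_comm]
      _ ≤ ∑ z ∈ layer X A 2, (#(back X A 1 z) + if #(back X A 1 z) = 2 then 1 else 0) :=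
          sum_le_sum hz3
      _ = ∑ z ∈ layer X A 2, #(back X A 1 z) +
            ∑ z ∈ layer X A 2, (if #(back X A 1 z) = 2 then 1 else 0) := sum_add_distrib
      _ = ∑ z ∈ layer X A 2, #(back X A 1 z) + #T := by rw [hTdef, card_filter]
  have hdegeq : ∑ z ∈ layer X A 2, #(back X A 1 z) =
      ∑ z ∈ layer X A 1, #((z +ᵥ A) ∩ layer X A 2) := by
    rw [sum_card_vadd_inter_eq]
    exact sum_congr rfl fun t _ => (card_vadd_neg_inter_layer_eq 1 t).symm
  have hdegle : ∑ z ∈ layer X A 1, #((z +ᵥ A) ∩ layer X A 2) ≤ #(layer X A 1) * 4 := by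
    have := sum_le_sum fun z hz => card_vadd_inter_layer_succ_le (X := X) (A := A) (i := 1) hz
    rw [sum_const, smul_eq_mul, hB] at this
    simpa [Nat.reduceAdd] using this
  -- (6) `|N_2| ≤ 8`: `|N_2| = 9` would force `d_+ ≡ 4` on `N_1`, `N_1 + A* ⊆ N_2`, and Vosper
  have hN2 : #(layer X A 2) ≤ 8 := by
    by_contra hgt
    have h9 : #(layer X A 2) = 9 := by omega
    have hall : ∀ z ∈ layer X A 1, #((z +ᵥ A) ∩ layer X A 2) = 4 := by
      intro z₀ hz₀
      by_contra hne
      have hle : #((z₀ +ᵥ A) ∩ layer X A 2) ≤ 3 := by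
        have := card_vadd_inter_layer_succ_le (X := X) (A := A) (i := 1) hz₀
        simp only [Nat.reduceAdd] at this
        rw [hB] at this
        omega
      have : ∑ z ∈ layer X A 1, #((z +ᵥ A) ∩ layer X A 2) + 1 ≤ #(layer X A 1) * 4 := by
        rw [← add_sum_erase _ _ hz₀]
        have h1 := sum_le_sum fun z (hz : z ∈ (layer X A 1).erase z₀) =>
          card_vadd_inter_layer_succ_le (X := X) (A := A) (i := 1) (mem_of_mem_erase hz)
        simp only [Nat.reduceAdd] at h1
        rw [sum_const, smul_eq_mul, card_erase_of_mem hz₀, hB] at h1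
        have := card_pos.2 ⟨z₀, hz₀⟩
        have e : (#(layer X A 1) - 1) * 4 + 4 = #(layer X A 1) * 4 := by omega
        omega
      omega
    have hincl : layer X A 1 + A.erase 0 ⊆ layer X A 2 := by
      intro w hw
      obtain ⟨z, hz, u, hu, rfl⟩ := mem_add.1 hw
      have hsub : (z +ᵥ A) ∩ layer X A 2 ⊆ z +ᵥ A.erase 0 :=
        vadd_inter_layer_succ_subset (i := 1) hz
      have heq := eq_of_subset_of_card_le hsub (by rw [card_vadd_finset, hB, hall z hz])
      have : z + u ∈ z +ᵥ A.erase 0 := mem_vadd_finset.2 ⟨u, hu, rfl⟩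
      rw [← heq] at this
      exact (mem_inter.1 this).2
    have hN1eq : #(layer X A 1) = 6 := by omega
    have hle := card_le_card hincl
    have hne : layer X A 1 + A.erase 0 ≠ univ := fun h => by
      rw [h, card_univ, ZMod.card] at hle
      omega
    have hCD := Vosper.cauchy_davenport_of_ne_univ (card_pos.1 (by omega))
      (card_pos.1 (by omega)) hne
    obtain ⟨d, -, -, hBd⟩ := vosper_inverse (A := layer X A 1) (B := A.erase 0) (by omega)
      (by omega) (by omega) (by omega)
    exact hAP d hBd
  -- (7) `|N_3| ≤ 10` (in-degrees `≥ 3`), `|N_4| ≤ 10` (`|N_4^{A*}| ≤ 6` by Vosper, plus the four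
  -- `N_4^V`, `|V| = 3`, one point each), `|N_5| ≤ 6`, `|N_6| ≤ 2`, `N_7 = ∅`
  have hN3 : #(layer X A 3) ≤ 10 := by
    have := mul_card_layer_succ_le (X := X) (A := A) (i := 2) (m := 3) (fun z hz => by
      by_contra hlt
      have h1 := hS3two _ (back_subset_erase_zero hz) (by omega)
      have h2 : z ∈ layerSub X A 3 (back X A 2 z) := mem_layerSub_succ.2 ⟨hz, Subset.rfl⟩
      rw [h1] at h2
      exact notMem_empty _ h2)
    simp only [Nat.reduceAdd] at this
    rw [hB] at this
    omega
  have hN4 : #(layer X A 4) ≤ 10 := by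
    have hcov : layer X A 4 ⊆ layerEq X A 4 (A.erase 0) ∪
        ((A.erase 0).powersetCard 3).biUnion fun V => layerEq X A 4 V := by
      intro z hz
      have hsub := back_subset_erase_zero hz
      have hzE : z ∈ layerEq X A 4 (back X A 3 z) := mem_layerEq_succ.2 ⟨hz, rfl⟩
      have hc := card_le_card hsub
      rw [hB] at hc
      rw [mem_union, mem_biUnion]
      by_cases h4 : #(back X A 3 z) = 4
      · left
        rwa [eq_of_subset_of_card_le hsub (by rw [hB, h4])] at hzE
      · by_cases h3 : #(back X A 3 z) = 3
        · right
          exact ⟨_, mem_powersetCard.2 ⟨hsub, h3⟩, hzE⟩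
        · exfalso
          have h1 := hS4two _ hsub (by omega)
          have h2 : z ∈ layerSub X A 4 (back X A 3 z) := mem_layerSub_succ.2 ⟨hz, Subset.rfl⟩
          rw [h1] at h2
          exact notMem_empty _ h2
    have hE : #(layerEq X A 4 (A.erase 0)) ≤ 6 := by
      rcases Nat.lt_or_ge #(layerEq X A 4 (A.erase 0)) 2 with h | h
      · omega
      · have := card_add_card_erase_le_of_forall h0A (N := layer X A 3) (fun z hz u hu => by
          rw [mem_layerEq_succ] at hz
          rw [← hz.2, mem_back] at hu
          rw [← sub_eq_add_neg]
          exact hu.2) hAP (by omega) (by omega) h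
        rw [hB] at this
        omega
    have hrest : #(((A.erase 0).powersetCard 3).biUnion fun V => layerEq X A 4 V) ≤ 4 := by
      refine card_biUnion_le.trans ?_
      calc ∑ V ∈ (A.erase 0).powersetCard 3, #(layerEq X A 4 V)
            ≤ ∑ V ∈ (A.erase 0).powersetCard 3, 1 :=
            sum_le_sum fun V hV => hE4three V (mem_powersetCard.1 hV).1 (mem_powersetCard.1 hV).2
        _ = 4 := by rw [sum_const, smul_eq_mul, mul_one, card_powersetCard, hB]; rfl
    exact (card_le_card hcov).trans ((card_union_le _ _).trans (by omega))
  have hN5 : #(layer X A 5) ≤ 6 := by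
    rcases Nat.lt_or_ge #(layer X A 5) 2 with h | h
    · omega
    · have := card_layer_add_card_erase_le h0A (i := 3) (hfull 4 le_rfl) hAP (by omega)
        (by simp only [Nat.reduceAdd]; omega) (by simpa using h)
      simp only [Nat.reduceAdd] at this
      rw [hB] at this
      omega
  have hN6 : #(layer X A 6) ≤ 2 := by
    rcases Nat.lt_or_ge #(layer X A 6) 2 with h | h
    · omega
    · have := card_layer_add_card_erase_le h0A (i := 4) (hfull 5 (by norm_num)) hAP (by omega)
        (by simp only [Nat.reduceAdd]; omega) (by simpa using h)
      simp only [Nat.reduceAdd] at this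
      rw [hB] at this
      omega
  have hN7 : layer X A 7 = ∅ := by
    by_contra hne
    have hne' := nonempty_iff_ne_empty.2 hne
    have h1 := card_layer_add_card_erase_le_succ hXne h0A (by omega) (i := 5)
      (hfull 6 (by norm_num)) hne'
    simp only [Nat.reduceAdd] at h1
    rw [hB] at h1
    have := hne'.card_pos
    rcases Nat.lt_or_ge #(layer X A 7) 2 with h | h
    · omega
    · have h2 := card_layer_add_card_erase_le h0A (i := 5) (hfull 6 (by norm_num)) hAP (by omega)
        (by simp only [Nat.reduceAdd]; omega) (by simpa using h)
      simp only [Nat.reduceAdd] at h2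
      rw [hB] at h2
      omega
  have hsum := card_add_sum_card_layer_eq hXne h0A (by omega) (n := 6) hN7
  simp only [sum_range_succ, sum_range_zero, zero_add, Nat.reduceAdd] at hsum
  omega

/-- A progression with difference `0` is a single point. [folklore] -/
private theorem apFinset_zero_subset' (a : ZMod p) (n : ℕ) :
    apFinset a (0 : ZMod p) n ⊆ {a} := by
  intro x hx
  obtain ⟨i, -, rfl⟩ := mem_apFinset.1 hx
  rw [nsmul_zero, add_zero]
  exact mem_singleton_self _

/-- **Lemma 18 = Theorem 14 (i).** «Let `X` and `p` be as in Theorem 14.  Let `A` be a `4`-atom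
of `X`.  Then `|A| = 4`.»  Hypotheses as used: `0 ∈ X`, `|X| ≥ 4`, `κ_4(X) ≤ |X| + 1`,
`p > |X| + 42`.  Reduction as printed: WLOG `0 ∈ A`; `|A| = 5` by Lemma 17; `A` contains no
five-term progression; if `A* = {a, a+d, a+2d, a+3d}` is a progression, pass to the translate
`A − a ∋ 0`, whose `(A − a)* = {−a, d, 2d, 3d}` is not a progression (a four-term `e`-progression
containing `d, 2d, 3d` has `e = ±d` (`eq_or_eq_neg_of_triple_subset`), then starts at `d`, so
`A − a = {0, d, …, 4d}` — a progression, excluded); then `false_of_isAtom_four_card_five`.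
[cite: HamidouneSerraZemor2006, §4, Lemma 18 and Theorem 14 (i)] -/
theorem card_eq_four_of_isAtom_four {X A : Finset (ZMod p)} (h0X : (0 : ZMod p) ∈ X)
    (hX4 : 4 ≤ #X) (hconn : Isoperimetric.conn 4 X ≤ #X + 1) (hp42 : #X + 42 < p)
    (hA : Isoperimetric.IsAtom 4 X A) : #A = 4 := by
  classical
  have h4 : 4 ≤ #A := hA.1.1.1
  have h5 := card_le_five_of_isAtom_four h0X hX4 hconn hp42 hA
  by_contra hne
  have hA5 : #A = 5 := by omega
  clear h4 h5 hne
  -- WLOG `0 ∈ A`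
  wlog h0A : (0 : ZMod p) ∈ A generalizing A
  · obtain ⟨a, ha⟩ : A.Nonempty := card_pos.1 (by omega)
    exact this (hA.vadd (-a)) (by rw [card_vadd_finset, hA5])
      (mem_vadd_finset.2 ⟨a, ha, by simp⟩)
  by_cases hAP : ∀ d : ZMod p, ¬ IsAP (A.erase 0) d
  · exact false_of_isAtom_four_card_five h0X hX4 hconn hp42 hA h0A hA5 hAP
  push Not at hAP
  obtain ⟨d, a, ha⟩ := hAP
  have hB : #(A.erase 0) = 4 := by rw [card_erase_of_mem h0A, hA5]
  rw [hB] at ha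
  have hd : d ≠ 0 := by
    rintro rfl
    have := card_le_card ((Finset.subset_of_eq ha).trans (apFinset_zero_subset' a 4))
    rw [hB, card_singleton] at this
    omega
  have haA : a ∈ A.erase 0 := by
    rw [ha]
    exact mem_apFinset.2 ⟨0, by norm_num, by rw [zero_nsmul, add_zero]⟩
  obtain ⟨-, haA'⟩ := mem_erase.1 haA
  -- the translate `A' = A − a ∋ 0`
  obtain ⟨A', hA'def⟩ : ∃ A' : Finset (ZMod p), A' = (-a) +ᵥ A := ⟨_, rfl⟩
  have hA' : Isoperimetric.IsAtom 4 X A' := hA'def ▸ hA.vadd (-a)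
  have h0A' : (0 : ZMod p) ∈ A' :=
    hA'def ▸ mem_vadd_finset.2 ⟨a, haA', by rw [vadd_eq_add, neg_add_cancel]⟩
  have hA'5 : #A' = 5 := by rw [hA'def, card_vadd_finset, hA5]
  have hB' : #(A'.erase 0) = 4 := by rw [card_erase_of_mem h0A', hA'5]
  -- `j d ∈ A' ∖ 0` for `1 ≤ j ≤ 3`
  have hmem : ∀ j : ℕ, j < 4 → 1 ≤ j → (j • d : ZMod p) ∈ A'.erase 0 := by
    intro j hj hj1
    rw [mem_erase]
    refine ⟨fun h0 => ?_, ?_⟩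
    · have := HamidouneRodseth.nat_eq_of_nsmul_eq hd (by omega : j < p) hp.out.pos
        (by rw [h0, zero_nsmul])
      omega
    · rw [hA'def]
      have hmemj : a + j • d ∈ A.erase 0 := by
        rw [ha]
        exact mem_apFinset.2 ⟨j, hj, rfl⟩
      exact mem_vadd_finset.2 ⟨a + j • d, mem_of_mem_erase hmemj, by
        rw [vadd_eq_add, neg_add_cancel_left]⟩
  refine false_of_isAtom_four_card_five h0X hX4 hconn hp42 hA' h0A' hA'5 fun e hAP' => ?_
  obtain ⟨b, hb⟩ := hAP'
  rw [hB'] at hb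
  have he : e ≠ 0 := by
    rintro rfl
    have := card_le_card ((Finset.subset_of_eq hb).trans (apFinset_zero_subset' b 4))
    rw [hB', card_singleton] at this
    omega
  have htriple : ({d, d + d, d + 2 • d} : Finset (ZMod p)) ⊆ apFinset b e 4 := by
    rw [← hb]
    intro y hy
    simp only [mem_insert, mem_singleton] at hy
    rcases hy with rfl | rfl | rfl
    · have := hmem 1 (by norm_num) le_rfl
      rwa [one_nsmul] at this
    · have := hmem 2 (by norm_num) (by norm_num)
      rwa [two_nsmul] at this
    · have := hmem 3 (by norm_num) (by norm_num)
      rwa [show (3 : ℕ) = 2 + 1 from rfl, succ_nsmul'] at this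
  have hed := eq_or_eq_neg_of_triple_subset hd he (by omega) htriple
  -- so `A' ∖ 0` is a four-term `d`-progression containing `d`: it is `{d, 2d, 3d, 4d}`
  obtain ⟨b', hb'⟩ : ∃ b' : ZMod p, A'.erase 0 = apFinset b' d 4 := by
    rcases hed with rfl | rfl
    · exact ⟨b, hb⟩
    · rw [Isoperimetric.apFinset_eq_apFinset_neg b (-d) (by norm_num : 1 ≤ 4), neg_neg] at hb
      exact ⟨_, hb⟩
  have hdmem : d ∈ A'.erase 0 := by
    have := hmem 1 (by norm_num) le_rfl
    rwa [one_nsmul] at this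
  rw [hb'] at hdmem
  obtain ⟨i, hi, hid⟩ := mem_apFinset.1 hdmem
  have hi0 : i = 0 := by
    by_contra hi0
    obtain ⟨i', rfl⟩ : ∃ i', i = i' + 1 := ⟨i - 1, by omega⟩
    have h0mem : b' + i' • d ∈ A'.erase 0 := by
      rw [hb']
      exact mem_apFinset.2 ⟨i', by omega, rfl⟩
    have e0 : b' + i' • d = 0 := by
      have h := hid
      rw [succ_nsmul, ← add_assoc] at h
      exact add_right_cancel (h.trans (zero_add d).symm)
    rw [e0] at h0mem
    exact (mem_erase.1 h0mem).1 rfl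
  subst hi0
  rw [zero_nsmul, add_zero] at hid
  subst hid
  -- `A' ⊇ {0, d, 2d, 3d, 4d}`
  have hS : apFinset 0 b' 5 ⊆ A' := by
    intro y hy
    obtain ⟨j, hj, rfl⟩ := mem_apFinset.1 hy
    rw [zero_add]
    rcases Nat.eq_zero_or_pos j with h | h
    · rw [h, zero_nsmul]; exact h0A'
    · obtain ⟨j', rfl⟩ : ∃ j', j = j' + 1 := ⟨j - 1, by omega⟩
      have hmemj : (j' + 1) • b' ∈ A'.erase 0 := by
        rw [hb']
        exact mem_apFinset.2 ⟨j', by omega, by rw [succ_nsmul']⟩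
      exact mem_of_mem_erase hmemj
  exact false_of_apFinset_subset h0X (by norm_num) hA' hd (m := 5) (by omega) hS (by norm_num)

/-- **Theorem 14 (i)**, packaged: under `0 ∈ X`, `|X| ≥ 4`, `κ_4(X) ≤ |X| + 1`, `p > |X| + 42`,
every `4`-atom of `X` has exactly four elements.
[cite: HamidouneSerraZemor2006, §4, Theorem 14 (i)] -/
theorem forall_isAtom_four_card_eq {X : Finset (ZMod p)} (h0X : (0 : ZMod p) ∈ X)
    (hX4 : 4 ≤ #X) (hconn : Isoperimetric.conn 4 X ≤ #X + 1) (hp42 : #X + 42 < p) :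
    ∀ A : Finset (ZMod p), Isoperimetric.IsAtom 4 X A → #A = 4 :=
  fun _ hA => card_eq_four_of_isAtom_four h0X hX4 hconn hp42 hA

end LemmaEighteen

/-! ## Towards Lemma 19 and Theorem 14 (ii): the partition of a layer by back-neighbour sets, and
the unique expression next to a progression -/

section LemmaNineteenBricks

variable {G : Type*} [AddCommGroup G] [DecidableEq G]
variable {X A : Finset G}

/-- Distinct back-neighbour sets give disjoint `N_i^V`. [cite: HamidouneSerraZemor2006, §4 (proof
of Lemma 19: «|N_2| = Σ_{V ⊂ X*} |N_2^V|»)] -/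
theorem disjoint_layerEq (i : ℕ) {V V' : Finset G} (hne : V ≠ V') :
    Disjoint (layerEq X A i V) (layerEq X A i V') :=
  disjoint_left.2 fun z hz hz' => hne (by
    rw [layerEq, mem_filter] at hz hz'
    exact hz.2.symm.trans hz'.2)

/-- **`|N_{i+1}| = Σ_V |N_{i+1}^V|`** over any family `𝒱` containing all back-neighbour sets of the
points of `N_{i+1}`. [cite: HamidouneSerraZemor2006, §4 (proof of Lemma 19:
«|N_2| = Σ_{V ⊂ X*} |N_2^V| = Σ_{V ⊂ X*, |V| = 2} |N_2^V| + |N_2^{X*}|»)] -/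
theorem card_layer_succ_eq_sum {𝒱 : Finset (Finset G)} {i : ℕ}
    (h𝒱 : ∀ z ∈ layer X A (i + 1), back X A i z ∈ 𝒱) :
    #(layer X A (i + 1)) = ∑ V ∈ 𝒱, #(layerEq X A (i + 1) V) := by
  classical
  have hcov : layer X A (i + 1) = 𝒱.biUnion fun V => layerEq X A (i + 1) V := by
    ext z
    rw [mem_biUnion]
    constructor
    · intro hz
      exact ⟨_, h𝒱 z hz, mem_layerEq_succ.2 ⟨hz, rfl⟩⟩
    · rintro ⟨V, -, hz⟩
      exact (mem_layerEq_succ.1 hz).1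
  rw [hcov, card_biUnion]
  intro V _ V' _ hne
  rw [Function.onFun]
  exact disjoint_layerEq _ hne

/-- `Σ_{V ∈ 𝒱} |N_i^V| ≤ |N_i|` for any family `𝒱` (the `N_i^V` are disjoint parts of `N_i`).
[cite: HamidouneSerraZemor2006, §4 (proof of Lemma 19)] -/
theorem sum_card_layerEq_le (𝒱 : Finset (Finset G)) (i : ℕ) :
    ∑ V ∈ 𝒱, #(layerEq X A i V) ≤ #(layer X A i) := by
  classical
  rw [← card_biUnion]
  · exact card_le_card (biUnion_subset.2 fun V _ => filter_subset _ _)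
  · intro V _ V' _ hne
    rw [Function.onFun]
    exact disjoint_layerEq _ hne

end LemmaNineteenBricks

section LemmaNineteenAP

variable {p : ℕ} [hp : Fact p.Prime]

/-- **Lemma 19, the case of a progression** («If `B` is an arithmetic progression of difference `d`
then … the sum `X + B` can be considered as a sum in `ℤ`, in which case the conclusion of the lemma
holds»), proved directly: if `B` is a `d`-progression (`d ≠ 0`) and `X + B ≠ ℤ/pℤ`, a point `z` of
`X + B` with `z − d ∉ X + B` (a run start, `Isoperimetric.one_le_card_vadd_sdiff`) is `x + b₀`
with `b₀` the first term of `B`, and every representation `z = x' + b'` has `b' = b₀` — so `z` is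
uniquely expressible.  (Deviation: the printed route goes through `ℓ_d(X) ≤ |X| + 2` and a lift to
`ℤ`; the run-start argument needs neither.) [cite: HamidouneSerraZemor2006, §4, Lemma 19 (proof,
first paragraph)] -/
theorem exists_unique_add_of_isAP {X B : Finset (ZMod p)} {d : ZMod p} (hd : d ≠ 0)
    (hB : IsAP B d) (hX : X.Nonempty) (hBne : B.Nonempty) (hne : X + B ≠ univ) :
    ∃ b ∈ B, ∃ x ∈ X, ∀ b' ∈ B, ∀ x' ∈ X, b' + x' = b + x → b' = b := by
  classical
  obtain ⟨b₀, hBeq⟩ := hB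
  have hSne : (X + B).Nonempty := hX.add hBne
  obtain ⟨w, hw⟩ : ((-d +ᵥ (X + B)) \ (X + B)).Nonempty :=
    card_pos.1 (Isoperimetric.one_le_card_vadd_sdiff hSne hne (neg_ne_zero.2 hd))
  rw [mem_sdiff, mem_vadd_finset] at hw
  obtain ⟨⟨z, hz, rfl⟩, hwS⟩ := hw
  obtain ⟨x, hx, y, hy, rfl⟩ := mem_add.1 hz
  -- every representation of `x + y` uses the first term `b₀` of `B`
  have key : ∀ x' ∈ X, ∀ y' ∈ B, x' + y' = x + y → y' = b₀ := by
    intro x' hx' y' hy' he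
    rw [hBeq] at hy'
    obtain ⟨i, hi, rfl⟩ := mem_apFinset.1 hy'
    rcases Nat.eq_zero_or_pos i with h0 | hpos
    · rw [h0, zero_nsmul, add_zero]
    · exfalso
      apply hwS
      obtain ⟨i', rfl⟩ : ∃ i', i = i' + 1 := ⟨i - 1, by omega⟩
      have hmem : b₀ + i' • d ∈ B := by
        rw [hBeq]
        exact mem_apFinset.2 ⟨i', by omega, rfl⟩
      have e : -d +ᵥ (x + y) = x' + (b₀ + i' • d) := by
        rw [vadd_eq_add, ← he, succ_nsmul]
        abel
      rw [e]
      exact add_mem_add hx' hmem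
  refine ⟨y, hy, x, hx, fun b' hb' x' hx' he => ?_⟩
  have he' : x' + b' = x + y := by rw [add_comm x' b', add_comm x y]; exact he
  rw [key x' hx' b' hb' he', key x hx y hy rfl]

end LemmaNineteenAP

/-! ## Lemma 19 and Theorem 14 (ii) -/

section LemmaNineteen

variable {p : ℕ} [hp : Fact p.Prime]

/-- A progression with difference `0` is a single point. [folklore] -/
private theorem apFinset_zero_subset'' (a : ZMod p) (n : ℕ) :
    apFinset a (0 : ZMod p) n ⊆ {a} := by
  intro x hx
  obtain ⟨i, -, rfl⟩ := mem_apFinset.1 hx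
  rw [nsmul_zero, add_zero]
  exact mem_singleton_self _

/-- Arithmetic of the count in Lemma 19, second layer. [cite: HamidouneSerraZemor2006, §4 (proof of
Lemma 19: «|N_2| ≤ Σ (|N_1^V| − 1)^+ + (|N_1| − 2) ≤ 6»)] -/
private theorem arith_two {N₁ N₂ a₁ b₁ c₁ t₁ a₂ b₂ c₂ t₂ : ℕ} (hN₁ : N₁ ≤ 5)
    (hs : a₁ + b₁ + c₁ + t₁ ≤ N₁) (ha : a₁ ≤ 3) (hb : b₁ ≤ 3) (hc : c₁ ≤ 3)
    (ha₂ : a₂ ≤ a₁ - 1) (hb₂ : b₂ ≤ b₁ - 1) (hc₂ : c₂ ≤ c₁ - 1) (ht₂ : t₂ ≤ N₁ - 2)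
    (hcov : N₂ ≤ a₂ + b₂ + c₂ + t₂) :
    N₂ ≤ 6 ∧ (a₂ - 1) + (b₂ - 1) + (c₂ - 1) ≤ 1 := by
  omega

/-- Arithmetic of the count in Lemma 19, third layer. [cite: HamidouneSerraZemor2006, §4 (proof of
Lemma 19: «|N_3| ≤ Σ (|N_2^V| − 1)^+ + (|N_2| − 2) ≤ 5»)] -/
private theorem arith_three {N₂ N₃ a₂ b₂ c₂ a₃ b₃ c₃ t₃ : ℕ} (hN₂ : N₂ ≤ 6)
    (hs : (a₂ - 1) + (b₂ - 1) + (c₂ - 1) ≤ 1)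
    (ha₃ : a₃ ≤ a₂ - 1) (hb₃ : b₃ ≤ b₂ - 1) (hc₃ : c₃ ≤ c₂ - 1) (ht₃ : t₃ ≤ N₂ - 2)
    (hcov : N₃ ≤ a₃ + b₃ + c₃ + t₃) : N₃ ≤ 5 ∧ a₃ ≤ 1 ∧ b₃ ≤ 1 ∧ c₃ ≤ 1 := by
  omega

/-- Arithmetic of the count in Lemma 19, higher layers («|N_4| = |N_4^{X*}| ≤ |N_3| − 2 ≤ 3 and
|N_5| ≤ |N_4| − 2 ≤ 1»). [cite: HamidouneSerraZemor2006, §4 (proof of Lemma 19)] -/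
private theorem arith_step {N N' a b c a' b' c' t' K : ℕ} (hN : N ≤ K + 2)
    (ha : a ≤ 1) (hb : b ≤ 1) (hc : c ≤ 1)
    (ha' : a' ≤ a - 1) (hb' : b' ≤ b - 1) (hc' : c' ≤ c - 1) (ht' : t' ≤ N - 2)
    (hcov : N' ≤ a' + b' + c' + t') : N' ≤ K ∧ a' ≤ 1 ∧ b' ≤ 1 ∧ c' ≤ 1 := by
  omega

/-- The final sum in Lemma 19: `p = |B| + Σ_{i ≤ 5} |N_i| ≤ |B| + 20`. [cite: HamidouneSerraZemor2006,
§4 (proof of Lemma 19: «Therefore, p ≤ |B| + Σ_{i=1}^5 |N_i| ≤ |B| + 20»)] -/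
private theorem arith_final {nB N₁ N₂ N₃ N₄ N₅ q : ℕ} (h₁ : N₁ ≤ 5) (h₂ : N₂ ≤ 6) (h₃ : N₃ ≤ 5)
    (h₄ : N₄ ≤ 3) (h₅ : N₅ ≤ 1) (hsum : nB + (N₁ + N₂ + N₃ + N₄ + N₅) = q) (hq : nB + 20 < q) :
    False := by
  omega

/-- **Lemma 19.** «Let `X, B ⊂ ℤ/pℤ` such that `|X| = 4`, `|B| ≥ 4`, `0 ∈ X ∩ B`, and
`|X + B| ≤ |X| + |B| + 1`.  If `p > |B| + 20`, then there is an element `z ∈ X + B` which can be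
uniquely written as `z = x + b` with `x ∈ X` and `b ∈ B`.»  (`0 ∈ B` is not used.)  Proof as
printed: if `B` is a progression, `exists_unique_add_of_isAP`; otherwise, with `X* = X ∖ 0 =
{x₁, x₂, x₃}` and the layers `N_i = N_i(B, X)`, non-uniqueness means `N_1^{x} = ∅`; `|N_1^{xy}| ≤ 3`
(else `|B + (X ∖ {x,y})| ≤ |B| + 1` and `B` is a progression); Lemma 6 gives
`|N_{i+1}^V| ≤ (|N_i^V| − 1)^+` for pairs `V` and `|N_{i+1}^{X*}| ≤ (|N_i| − 2)^+`, whence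
`|N_1| ≤ 5`, `|N_2| ≤ 6`, `|N_3| ≤ 5`, `|N_4| ≤ 3`, `|N_5| ≤ 1`, `N_6 = ∅` and `p ≤ |B| + 20`.
[cite: HamidouneSerraZemor2006, §4, Lemma 19] -/
theorem exists_unique_add_of_card_four {X B : Finset (ZMod p)} (h0X : (0 : ZMod p) ∈ X)
    (hX4 : #X = 4) (hB4 : 4 ≤ #B) (hXB : #(X + B) ≤ #X + #B + 1) (hp20 : #B + 20 < p) :
    ∃ b ∈ B, ∃ x ∈ X, ∀ b' ∈ B, ∀ x' ∈ X, b' + x' = b + x → b' = b := by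
  classical
  have hXne : X.Nonempty := ⟨0, h0X⟩
  have hBne : B.Nonempty := card_pos.1 (by omega)
  have hne : X + B ≠ univ := fun h => by
    rw [h, card_univ, ZMod.card] at hXB
    omega
  have hBu : B ≠ univ := fun h => by
    rw [h, card_univ, ZMod.card] at hp20
    omega
  -- the case of a progression
  by_cases hAP : ∃ d, IsAP B d
  · obtain ⟨d, hBd⟩ := hAP
    have hd : d ≠ 0 := by
      rintro rfl
      obtain ⟨b, hb⟩ := hBd
      have := card_le_card ((Finset.subset_of_eq hb).trans (apFinset_zero_subset'' b _))
      rw [card_singleton] at this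
      omega
    exact exists_unique_add_of_isAP hd hBd hXne hBne hne
  push Not at hAP
  -- otherwise: suppose no sum is uniquely expressible
  by_contra hnu
  push Not at hnu
  -- `N_1^{{x}} = ∅`, hence `N_j^{⊆U} = ∅` for `|U| ≤ 1`
  have hE1one : ∀ x : ZMod p, layerEq B X 1 {x} = ∅ := by
    intro x
    by_contra hne'
    obtain ⟨z, hz⟩ := nonempty_iff_ne_empty.2 hne'
    obtain ⟨hxX, hzB, huniq⟩ := unique_add_of_mem_layerEq_singleton hz
    obtain ⟨b', hb', x', hx', he, hbne⟩ := hnu (z - x) hzB x hxX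
    have hx'x : x' = x := huniq x' hx' b' hb' (by rw [add_comm x' b', he, add_comm])
    rw [hx'x] at he
    exact hbne (add_right_cancel he)
  have hSone : ∀ j : ℕ, 1 ≤ j → ∀ U : Finset (ZMod p), #U ≤ 1 → layerSub B X j U = ∅ := by
    intro j hj U hU1
    refine layerSub_eq_empty_of_le le_rfl hj (layerSub_succ_eq_empty_of_forall fun V hV hVne => ?_)
    obtain ⟨a, rfl⟩ : ∃ a, V = {a} :=
      card_eq_one.1 (le_antisymm ((card_le_card hV).trans hU1) hVne.card_pos)
    exact hE1one a
  have hEone : ∀ j : ℕ, ∀ U : Finset (ZMod p), #U ≤ 1 → layerEq B X (j + 1) U = ∅ :=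
    fun j U hU1 => subset_empty.1 ((layerEq_subset_layerSub _).trans
      (Finset.subset_of_eq (hSone (j + 1) (by omega) U hU1)))
  have hback2 : ∀ j : ℕ, ∀ z ∈ layer B X (j + 1), 2 ≤ #(back B X j z) := by
    intro j z hz
    by_contra hlt
    have h1 := hSone (j + 1) (by omega) _ (by omega : #(back B X j z) ≤ 1)
    have h2 : z ∈ layerSub B X (j + 1) (back B X j z) := mem_layerSub_succ.2 ⟨hz, Subset.rfl⟩
    rw [h1] at h2
    exact notMem_empty _ h2
  -- `|N_1| ≤ 5`
  have hN1 : #(layer B X 1) ≤ 5 := by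
    have := card_layer_one_add (X := B) h0X
    omega
  -- pairs: `|N_1^{V}| ≤ 3` (else `B + (X ∖ V) = B + {0, e}` is small and `B` a progression)
  have hT3 : #(X.erase 0) = 3 := by rw [card_erase_of_mem h0X, hX4]
  have hE1two : ∀ V ⊆ X.erase 0, #V = 2 → #(layerEq B X 1 V) ≤ 3 := by
    intro V hV hV2
    by_contra hlt
    have h0V : (0 : ZMod p) ∉ V := fun h => (mem_erase.1 (hV h)).1 rfl
    have hdel := card_sdiff_add (X := B) h0X h0V
    have hsub : #(layerEq B X 1 V) ≤ #(layerSub B X 1 V) := card_le_card (layerEq_subset_layerSub 1)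
    have hT2 : #(X \ V) = 2 := by
      rw [card_sdiff_of_subset (hV.trans (erase_subset _ _))]
      omega
    have h0T : (0 : ZMod p) ∈ X \ V := mem_sdiff.2 ⟨h0X, h0V⟩
    obtain ⟨e, he⟩ := card_eq_one.1
      (by rw [card_erase_of_mem h0T, hT2] : #((X \ V).erase 0) = 1)
    have he0 : e ≠ 0 := by
      have : e ∈ (X \ V).erase 0 := by rw [he]; exact mem_singleton_self e
      exact (mem_erase.1 this).1
    have hTe : X \ V = {0, e} := by rw [← insert_erase h0T, he]
    rw [hTe] at hdel
    obtain ⟨s, hs⟩ := exists_eq_apFinset_of_card_pair_add he0 hBu (by omega)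
    exact hAP e ⟨s, hs⟩
  -- Lemma 6 counts: pairs lose one per layer, the triple `X*` loses two
  have hpair : ∀ V ⊆ X.erase 0, #V = 2 → ∀ j : ℕ, 1 ≤ j →
      #(layerEq B X (j + 1) V) ≤ #(layerEq B X j V) - 1 := by
    intro V hV hV2 j hj
    rcases (layerEq B X (j + 1) V).eq_empty_or_nonempty with h | hne'
    · rw [h, card_empty]
      exact Nat.zero_le _
    · obtain ⟨j', rfl⟩ : ∃ j', j = j' + 1 := ⟨j - 1, by omega⟩
      have h6 := card_layerEq_add_card_le hBne h0X (i := j' + 1) (by omega) hne'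
      have hsub : layerSub B X (j' + 1) V ⊆ layerEq B X (j' + 1) V :=
        layerSub_succ_subset_layerEq_of_forall fun U hU hUV hUne =>
          hEone j' U (by have := card_lt_card (hU.ssubset_of_ne hUV); omega)
      have := card_le_card hsub
      omega
  have htrip : ∀ j : ℕ, 1 ≤ j →
      #(layerEq B X (j + 1) (X.erase 0)) ≤ #(layer B X j) - 2 := by
    intro j hj
    rcases (layerEq B X (j + 1) (X.erase 0)).eq_empty_or_nonempty with h | hne'
    · rw [h, card_empty]
      exact Nat.zero_le _
    · have h6 := card_layerEq_add_card_le hBne h0X (U := X.erase 0) hj hne'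
      have := card_le_card (layerSub_subset_layer (X := B) (Y := X) (U := X.erase 0) j)
      omega
  -- `X ∖ 0 = {x₁, x₂, x₃}`; the back-neighbour sets are `V₁ = {x₁,x₂}`, `V₂ = {x₁,x₃}`,
  -- `V₃ = {x₂,x₃}` or `T = X ∖ 0`
  obtain ⟨x₁, x₂, x₃, h12, h13, h23, hTeq⟩ := card_eq_three.1 hT3
  obtain ⟨T, hTdef⟩ : ∃ T : Finset (ZMod p), T = X.erase 0 := ⟨_, rfl⟩
  obtain ⟨V₁, hV₁⟩ : ∃ V : Finset (ZMod p), V = {x₁, x₂} := ⟨_, rfl⟩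
  obtain ⟨V₂, hV₂⟩ : ∃ V : Finset (ZMod p), V = {x₁, x₃} := ⟨_, rfl⟩
  obtain ⟨V₃, hV₃⟩ : ∃ V : Finset (ZMod p), V = {x₂, x₃} := ⟨_, rfl⟩
  have hV₁T : V₁ ⊆ X.erase 0 := by
    rw [hV₁, hTeq]
    intro w hw
    simp only [mem_insert, mem_singleton] at hw ⊢
    tauto
  have hV₂T : V₂ ⊆ X.erase 0 := by
    rw [hV₂, hTeq]
    intro w hw
    simp only [mem_insert, mem_singleton] at hw ⊢
    tauto
  have hV₃T : V₃ ⊆ X.erase 0 := by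
    rw [hV₃, hTeq]
    intro w hw
    simp only [mem_insert, mem_singleton] at hw ⊢
    tauto
  have hV₁2 : #V₁ = 2 := by rw [hV₁, card_pair_eq_two_iff.2 h12]
  have hV₂2 : #V₂ = 2 := by rw [hV₂, card_pair_eq_two_iff.2 h13]
  have hV₃2 : #V₃ = 2 := by rw [hV₃, card_pair_eq_two_iff.2 h23]
  have hTT : T ⊆ X.erase 0 := Finset.subset_of_eq hTdef
  -- every `W ⊆ X ∖ 0` with at least two elements is one of these four sets
  have henum : ∀ W ⊆ X.erase 0, 2 ≤ #W → W = V₁ ∨ W = V₂ ∨ W = V₃ ∨ W = T := by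
    intro W hW hW2
    by_cases hW3 : 3 ≤ #W
    · right; right; right
      rw [hTdef]
      exact eq_of_subset_of_card_le hW (by omega)
    have hW2' : #W = 2 := by omega
    have hmem : ∀ w ∈ W, w = x₁ ∨ w = x₂ ∨ w = x₃ := fun w hw => by
      have := hW hw
      rw [hTeq] at this
      simpa only [mem_insert, mem_singleton] using this
    by_cases h1 : x₁ ∈ W
    · by_cases h2 : x₂ ∈ W
      · left
        symm
        rw [hV₁]
        exact eq_of_subset_of_card_le (insert_subset_iff.2 ⟨h1, singleton_subset_iff.2 h2⟩)
          (by rw [hW2', card_pair_eq_two_iff.2 h12])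
      · right; left
        rw [hV₂]
        refine eq_of_subset_of_card_le (fun w hw => ?_) (by rw [hW2', card_pair_eq_two_iff.2 h13])
        rcases hmem w hw with rfl | rfl | rfl
        · simp
        · exact absurd hw h2
        · simp
    · right; right; left
      rw [hV₃]
      refine eq_of_subset_of_card_le (fun w hw => ?_) (by rw [hW2', card_pair_eq_two_iff.2 h23])
      rcases hmem w hw with rfl | rfl | rfl
      · exact absurd hw h1
      · simp
      · simp
  -- the four sets are distinct
  have hx₂V₂ : x₂ ∉ V₂ := by
    rw [hV₂]; simp only [mem_insert, mem_singleton, not_or]; exact ⟨fun h => h12 h.symm, h23⟩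
  have hx₁V₃ : x₁ ∉ V₃ := by
    rw [hV₃]; simp only [mem_insert, mem_singleton, not_or]; exact ⟨h12, h13⟩
  have hV₁V₂ : V₁ ≠ V₂ := fun h => hx₂V₂ (h ▸ (by rw [hV₁]; simp : x₂ ∈ V₁))
  have hV₁V₃ : V₁ ≠ V₃ := fun h => hx₁V₃ (h ▸ (by rw [hV₁]; simp : x₁ ∈ V₁))
  have hV₂V₃ : V₂ ≠ V₃ := fun h => hx₁V₃ (h ▸ (by rw [hV₂]; simp : x₁ ∈ V₂))
  have hV₁T' : V₁ ≠ T := fun h => by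
    have := hV₁2; rw [h, hTdef, hT3] at this; omega
  have hV₂T' : V₂ ≠ T := fun h => by
    have := hV₂2; rw [h, hTdef, hT3] at this; omega
  have hV₃T' : V₃ ≠ T := fun h => by
    have := hV₃2; rw [h, hTdef, hT3] at this; omega
  -- `|N_{j+1}| ≤ Σ` over the four sets, and `Σ ≤ |N_1|` at the first layer
  have hcov : ∀ j : ℕ, #(layer B X (j + 1)) ≤ #(layerEq B X (j + 1) V₁) +
      #(layerEq B X (j + 1) V₂) + #(layerEq B X (j + 1) V₃) + #(layerEq B X (j + 1) T) := by
    intro j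
    have hsub : layer B X (j + 1) ⊆ layerEq B X (j + 1) V₁ ∪ layerEq B X (j + 1) V₂ ∪
        layerEq B X (j + 1) V₃ ∪ layerEq B X (j + 1) T := by
      intro z hz
      have hzE : z ∈ layerEq B X (j + 1) (back B X j z) := mem_layerEq_succ.2 ⟨hz, rfl⟩
      simp only [mem_union]
      rcases henum _ (back_subset_erase_zero hz) (hback2 j z hz) with h | h | h | h <;>
        rw [h] at hzE <;> tauto
    exact (card_le_card hsub).trans ((card_union_le _ _).trans (by
      have h1 := card_union_le (layerEq B X (j + 1) V₁ ∪ layerEq B X (j + 1) V₂)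
        (layerEq B X (j + 1) V₃)
      have h2 := card_union_le (layerEq B X (j + 1) V₁) (layerEq B X (j + 1) V₂)
      omega))
  have hsum1 : #(layerEq B X 1 V₁) + #(layerEq B X 1 V₂) + #(layerEq B X 1 V₃) +
      #(layerEq B X 1 T) ≤ #(layer B X 1) := by
    have hd12 := disjoint_layerEq (X := B) (A := X) 1 hV₁V₂
    have hd13 := disjoint_layerEq (X := B) (A := X) 1 hV₁V₃
    have hd23 := disjoint_layerEq (X := B) (A := X) 1 hV₂V₃
    have hd1T := disjoint_layerEq (X := B) (A := X) 1 hV₁T'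
    have hd2T := disjoint_layerEq (X := B) (A := X) 1 hV₂T'
    have hd3T := disjoint_layerEq (X := B) (A := X) 1 hV₃T'
    have e12 := card_union_of_disjoint hd12
    have e123 := card_union_of_disjoint (disjoint_union_left.2 ⟨hd13, hd23⟩)
    have e1234 := card_union_of_disjoint
      (disjoint_union_left.2 ⟨disjoint_union_left.2 ⟨hd1T, hd2T⟩, hd3T⟩)
    have hsub : layerEq B X 1 V₁ ∪ layerEq B X 1 V₂ ∪ layerEq B X 1 V₃ ∪ layerEq B X 1 T ⊆
        layer B X 1 := by
      intro z hz
      simp only [mem_union] at hz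
      rcases hz with ((hz | hz) | hz) | hz <;> exact filter_subset _ _ hz
    have := card_le_card hsub
    omega
  have ha1 := hE1two V₁ hV₁T hV₁2
  have hb1 := hE1two V₂ hV₂T hV₂2
  have hc1 := hE1two V₃ hV₃T hV₃2
  rw [← hTdef] at htrip
  have ha2 : #(layerEq B X 2 V₁) ≤ #(layerEq B X 1 V₁) - 1 := by
    have := hpair V₁ hV₁T hV₁2 1 (by norm_num)
    simpa [Nat.reduceAdd] using this
  have ha3 : #(layerEq B X 3 V₁) ≤ #(layerEq B X 2 V₁) - 1 := by
    have := hpair V₁ hV₁T hV₁2 2 (by norm_num)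
    simpa [Nat.reduceAdd] using this
  have ha4 : #(layerEq B X 4 V₁) ≤ #(layerEq B X 3 V₁) - 1 := by
    have := hpair V₁ hV₁T hV₁2 3 (by norm_num)
    simpa [Nat.reduceAdd] using this
  have ha5 : #(layerEq B X 5 V₁) ≤ #(layerEq B X 4 V₁) - 1 := by
    have := hpair V₁ hV₁T hV₁2 4 (by norm_num)
    simpa [Nat.reduceAdd] using this
  have ha6 : #(layerEq B X 6 V₁) ≤ #(layerEq B X 5 V₁) - 1 := by
    have := hpair V₁ hV₁T hV₁2 5 (by norm_num)
    simpa [Nat.reduceAdd] using this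
  have hb2 : #(layerEq B X 2 V₂) ≤ #(layerEq B X 1 V₂) - 1 := by
    have := hpair V₂ hV₂T hV₂2 1 (by norm_num)
    simpa [Nat.reduceAdd] using this
  have hb3 : #(layerEq B X 3 V₂) ≤ #(layerEq B X 2 V₂) - 1 := by
    have := hpair V₂ hV₂T hV₂2 2 (by norm_num)
    simpa [Nat.reduceAdd] using this
  have hb4 : #(layerEq B X 4 V₂) ≤ #(layerEq B X 3 V₂) - 1 := by
    have := hpair V₂ hV₂T hV₂2 3 (by norm_num)
    simpa [Nat.reduceAdd] using this
  have hb5 : #(layerEq B X 5 V₂) ≤ #(layerEq B X 4 V₂) - 1 := by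
    have := hpair V₂ hV₂T hV₂2 4 (by norm_num)
    simpa [Nat.reduceAdd] using this
  have hb6 : #(layerEq B X 6 V₂) ≤ #(layerEq B X 5 V₂) - 1 := by
    have := hpair V₂ hV₂T hV₂2 5 (by norm_num)
    simpa [Nat.reduceAdd] using this
  have hc2 : #(layerEq B X 2 V₃) ≤ #(layerEq B X 1 V₃) - 1 := by
    have := hpair V₃ hV₃T hV₃2 1 (by norm_num)
    simpa [Nat.reduceAdd] using this
  have hc3 : #(layerEq B X 3 V₃) ≤ #(layerEq B X 2 V₃) - 1 := by
    have := hpair V₃ hV₃T hV₃2 2 (by norm_num)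
    simpa [Nat.reduceAdd] using this
  have hc4 : #(layerEq B X 4 V₃) ≤ #(layerEq B X 3 V₃) - 1 := by
    have := hpair V₃ hV₃T hV₃2 3 (by norm_num)
    simpa [Nat.reduceAdd] using this
  have hc5 : #(layerEq B X 5 V₃) ≤ #(layerEq B X 4 V₃) - 1 := by
    have := hpair V₃ hV₃T hV₃2 4 (by norm_num)
    simpa [Nat.reduceAdd] using this
  have hc6 : #(layerEq B X 6 V₃) ≤ #(layerEq B X 5 V₃) - 1 := by
    have := hpair V₃ hV₃T hV₃2 5 (by norm_num)
    simpa [Nat.reduceAdd] using this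
  have ht2 : #(layerEq B X 2 T) ≤ #(layer B X 1) - 2 := by
    have := htrip 1 (by norm_num)
    simpa [Nat.reduceAdd] using this
  have ht3 : #(layerEq B X 3 T) ≤ #(layer B X 2) - 2 := by
    have := htrip 2 (by norm_num)
    simpa [Nat.reduceAdd] using this
  have ht4 : #(layerEq B X 4 T) ≤ #(layer B X 3) - 2 := by
    have := htrip 3 (by norm_num)
    simpa [Nat.reduceAdd] using this
  have ht5 : #(layerEq B X 5 T) ≤ #(layer B X 4) - 2 := by
    have := htrip 4 (by norm_num)
    simpa [Nat.reduceAdd] using this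
  have ht6 : #(layerEq B X 6 T) ≤ #(layer B X 5) - 2 := by
    have := htrip 5 (by norm_num)
    simpa [Nat.reduceAdd] using this
  have hN1le : #(layer B X 1) ≤ #(layerEq B X 1 V₁) + #(layerEq B X 1 V₂) +
      #(layerEq B X 1 V₃) + #(layerEq B X 1 T) := by
    have := hcov 0
    simpa [Nat.reduceAdd] using this
  have hN2le : #(layer B X 2) ≤ #(layerEq B X 2 V₁) + #(layerEq B X 2 V₂) +
      #(layerEq B X 2 V₃) + #(layerEq B X 2 T) := by
    have := hcov 1
    simpa [Nat.reduceAdd] using this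
  have hN3le : #(layer B X 3) ≤ #(layerEq B X 3 V₁) + #(layerEq B X 3 V₂) +
      #(layerEq B X 3 V₃) + #(layerEq B X 3 T) := by
    have := hcov 2
    simpa [Nat.reduceAdd] using this
  have hN4le : #(layer B X 4) ≤ #(layerEq B X 4 V₁) + #(layerEq B X 4 V₂) +
      #(layerEq B X 4 V₃) + #(layerEq B X 4 T) := by
    have := hcov 3
    simpa [Nat.reduceAdd] using this
  have hN5le : #(layer B X 5) ≤ #(layerEq B X 5 V₁) + #(layerEq B X 5 V₂) +
      #(layerEq B X 5 V₃) + #(layerEq B X 5 T) := by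
    have := hcov 4
    simpa [Nat.reduceAdd] using this
  have hN6le : #(layer B X 6) ≤ #(layerEq B X 6 V₁) + #(layerEq B X 6 V₂) +
      #(layerEq B X 6 V₃) + #(layerEq B X 6 T) := by
    have := hcov 5
    simpa [Nat.reduceAdd] using this
  -- the count: `|N_2| ≤ 6`, `|N_3| ≤ 5`, `|N_4| ≤ 3`, `|N_5| ≤ 1`, `N_6 = ∅`
  obtain ⟨hN2, hs2⟩ := arith_two hN1 hsum1 ha1 hb1 hc1 ha2 hb2 hc2 ht2 hN2le
  obtain ⟨hN3, ha3', hb3', hc3'⟩ := arith_three hN2 hs2 ha3 hb3 hc3 ht3 hN3le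
  obtain ⟨hN4, ha4', hb4', hc4'⟩ :=
    arith_step (K := 3) hN3 ha3' hb3' hc3' ha4 hb4 hc4 ht4 hN4le
  obtain ⟨hN5, ha5', hb5', hc5'⟩ :=
    arith_step (K := 1) hN4 ha4' hb4' hc4' ha5 hb5 hc5 ht5 hN5le
  obtain ⟨hN6, -, -, -⟩ :=
    arith_step (K := 0) (hN5.trans (by norm_num)) ha5' hb5' hc5' ha6 hb6 hc6 ht6 hN6le
  have hN6' : layer B X 6 = ∅ := by
    rw [← card_eq_zero]
    exact Nat.le_zero.1 hN6
  have hX2 : 2 ≤ #X := by rw [hX4]; norm_num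
  have hsum := card_add_sum_card_layer_eq hBne h0X hX2 (n := 5) hN6'
  simp only [sum_range_succ, sum_range_zero, zero_add, Nat.reduceAdd] at hsum
  exact arith_final hN1 hN2 hN3 hN4 hN5 hsum hp20

/-- **Proposition 8 without `k ≤ |B|`** (the form Theorem 14 (ii) uses for `k = 5`, `|X| = 4`):
`0 ∈ B`, `|B| ≥ 2`, `A` a `k`-atom of `B` (`k ≥ 2`), `κ_k(B) ≤ |B| + m`, and
`m² + 6m + 12 < p + |B|` ⇒ `|A| ≤ m + k + 1`.  The printed proof (as formalised in
`Isoperimetric.IsAtom.card_le_of_conn_le`) uses `k ≤ |B|` only to pass from `p + k` to `p + |B|`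
in the numerical hypothesis; here that hypothesis is assumed with `|B|` directly.
[cite: HamidouneSerraZemor2006, §2, Proposition 8 (proof)] -/
theorem card_le_of_conn_le' {B : Finset (ZMod p)} {k m : ℕ}
    (h0 : (0 : ZMod p) ∈ B) (hk2 : 2 ≤ k) (hB2 : 2 ≤ #B) (hm : Isoperimetric.conn k B ≤ #B + m)
    (hpk : m * m + 6 * m + 12 < p + #B) {A : Finset (ZMod p)} (hA : Isoperimetric.IsAtom k B A) :
    #A ≤ m + k + 1 := by
  classical
  have hcardG : Fintype.card (ZMod p) = p := ZMod.card p
  -- WLOG `0 ∈ A`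
  wlog h0A : (0 : ZMod p) ∈ A generalizing A
  · obtain ⟨a, ha⟩ : A.Nonempty := card_pos.1 (by have := hA.1.1.1; omega)
    have := this (hA.vadd (-a)) (mem_vadd_finset.2 ⟨a, ha, by simp⟩)
    rwa [card_vadd_finset] at this
  have hAa := hA.1.1
  have hAf := hA.1.2
  unfold Isoperimetric.IsAdm at hAa
  rw [hcardG] at hAa
  have hAB := Isoperimetric.card_le_card_add h0 A
  obtain ⟨hD, -⟩ := hA.1.dual h0
  have hnegD : Isoperimetric.IsFragment k B (-(univ \ (A + B))) := by
    have := hD.neg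
    rwa [neg_neg] at this
  have hAC : #A ≤ #(univ \ (A + B)) := by
    have := hA.2 _ hnegD
    rwa [card_neg] at this
  rw [card_sdiff_of_subset (subset_univ _), card_univ, hcardG] at hAC
  have hBA : B + A = A + B := add_comm B A
  have hadmB : Isoperimetric.IsAdm 2 A B := ⟨by omega, by rw [hBA, hcardG]; omega⟩
  have hκA := Isoperimetric.conn_le hadmB
  rw [hBA] at hκA
  have hinter : ∀ u : ZMod p, u ≠ 0 → #((u +ᵥ A) ∩ A) ≤ k - 1 := by
    intro u hu
    have hne : u +ᵥ A ≠ A := by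
      intro hper
      have hAuniv := Isoperimetric.eq_univ_of_vadd_eq ⟨0, h0A⟩ hu hper
      rw [hAuniv] at hAa
      have := Isoperimetric.card_le_card_add h0 (univ : Finset (ZMod p))
      rw [card_univ, hcardG] at this
      omega
    by_contra hlt
    exact hne ((hA.vadd u).eq_of_le_card_inter h0 hA (by omega))
  have hsplit : ∀ u : ZMod p, #((u +ᵥ A) \ A) + #((u +ᵥ A) ∩ A) = #A := fun u => by
    rw [card_sdiff_add_card_inter, card_vadd_finset]
  rcases Nat.lt_or_ge (Isoperimetric.conn k B) #B with hlt | hge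
  · have hltA : Isoperimetric.conn 2 A < #A := by omega
    obtain ⟨u, hu, h1⟩ :=
      Isoperimetric.exists_card_vadd_sdiff_le_one_of_conn_lt (by omega) ⟨B, hadmB⟩ hltA
    have := hinter u hu
    have := hsplit u
    omega
  · obtain ⟨m', hm'⟩ : ∃ m', Isoperimetric.conn k B = #B + m' := ⟨Isoperimetric.conn k B - #B, by omega⟩
    have hm'le : m' ≤ m := by omega
    have hmA : Isoperimetric.conn 2 A ≤ #A + m' := by omega
    have hAp : #A + (m' + 3) * (m' + 4) / 2 < p := by
      have heven : (m' + 3) * (m' + 4) / 2 * 2 = (m' + 3) * (m' + 4) :=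
        Nat.div_mul_cancel (Nat.even_mul_succ_self (m' + 3)).two_dvd
      have e1 : (m' + 3) * (m' + 4) / 2 * 2 = m' * m' + 7 * m' + 12 := by rw [heven]; ring
      have hmono : m' * m' + 6 * m' ≤ m * m + 6 * m := by nlinarith
      have h2A : 2 * #A + #B + m' ≤ p := by omega
      generalize (m' + 3) * (m' + 4) / 2 = q at e1 ⊢
      generalize m' * m' = mm' at e1 hmono
      generalize m * m = mm at hmono hpk
      omega
    obtain ⟨u, hu, huA⟩ := Isoperimetric.exists_card_vadd_sdiff_le h0A ⟨B, hadmB⟩ hmA hAp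
    have := hinter u hu
    have := hsplit u
    omega

/-- **Theorem 14 (ii).** «If `|X| = 4` then the `5`-atoms of `X` have cardinality `5`»: for
`0 ∈ X ⊆ ℤ/pℤ` with `|X| = 4`, `κ_5(X) ≤ |X| + 1` and `p > |X| + 42`, every `5`-atom `B` of `X`
has `|B| = 5` — by Proposition 8 (`|B| ≤ 7`), Lemma 19 (a uniquely expressible sum, as
`p > 27 ≥ |B| + 20`) and Lemma 15.  (The paper's `p ≥ 29` suffices; we keep Theorem 14's
hypothesis.) [cite: HamidouneSerraZemor2006, §4, Theorem 14 (ii) (proof after Lemma 19)] -/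
theorem card_eq_five_of_isAtom_five {X B : Finset (ZMod p)} (h0X : (0 : ZMod p) ∈ X)
    (hX4 : #X = 4) (hconn : Isoperimetric.conn 5 X ≤ #X + 1) (hp42 : #X + 42 < p)
    (hB : Isoperimetric.IsAtom 5 X B) : #B = 5 := by
  classical
  have h5 : 5 ≤ #B := hB.1.1.1
  have hB7 : #B ≤ 7 := card_le_of_conn_le' h0X (by norm_num) (by omega) hconn (by omega) hB
  have hfrag := hB.1.2
  have hBX : #B ≤ #(B + X) := card_le_card_add_right ⟨0, h0X⟩
  have hXB : #(X + B) ≤ #X + #B + 1 := by rw [add_comm]; omega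
  obtain ⟨b, hb, x, hx, huniq⟩ :=
    exists_unique_add_of_card_four h0X hX4 (by omega) hXB (by omega)
  exact card_eq_of_unique_add hB hb hx huniq

end LemmaNineteen

end AtomLayers

end Literature.Combinatorics.Additive
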